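import Literature.Computability.Cryptography.BlumMicaliAlgorithm
import Literature.Computability.Complexity.StackScript
import Literature.Computability.Complexity.StackOracle
import HarnessLib

/-!
# The Blum–Micali reduction on a stack machine, I: the vote, the selector, the descent

Trunk T-CRYPTO (Literature/Computability/Cryptography); step (e) of the discharge of the named fact
`Literature.Computability.Cryptography.blumMicali_halfPredicate_dlog` (`BlumMicali.lean`; Blum–Micali 1984,
Theorem 3). `BlumMicaliAlgorithm.lean` reduced that fact to `bmOracleAlg_isPolyTime`: the transcript
step function of the oracle computation `bmComp Q` is polynomial-time in Mathlib's `TM2` model. This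
file begins the machine: a structured stack program (`StackPrograms.lean`) over the numeric procedure
layer (`StackNumeric.lean`, scripts `StackScript.lean`) that *replays* `bmComp Q` against the
recorded oracle answers (`StackOracle.lean`: `Com.Impl`, `qAsk`, `impl_query`, `impl_forEach`).

* Registers. The user bank is `BC ⊕ BV`: the constants bank `BC` (the parsed `p, g, y` and the
  parameters `g⁻¹, h = (p-1)/2, g^h, p-1, q = Q(|p|), m, k, S, ℓ = |p|`, the `2`-adic data
  `p - 1 = 2^s t`, `(t+1)/2`, `z⁻¹ = g^{p-1-t}`, `2^s`, written once by the parameter phase) and the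
  variables bank `BV` (coins, loop counters, loop state, scratch). Between two fragments the user bank
  is `encSt c v` for `c : Consts` (values of `BC`, `mkC Q p g y` for an instance) and `v : Vars`
  (typed contents of the *stateful* registers of `BV`; all scratch registers empty). `Bnd Q p g y N`
  collects the guard (`p > 2`, `0 < g < p`, `y < p`) and the size bound `N` on numerals, unary
  counters and queries under which every fragment runs in `O((N+1)^e)` steps.
* `impl_vote` — the vote program `voteProg` implements one vote `bmVoteC` (Blum–Micali's Lemma 2:
  read `k + 1` coins, shift `r`, ask the bits of `x g^r` and `x g^{r+h}`, tally
  `if b₁ = b₂ then coin else b₁`), consuming its coin block, in `6600 (N+1)³` steps.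
* `runs_sqrtProg` — square roots modulo `p` through the generator (`bmSqrt`: Adleman–Manders–Miller /
  Pohlig–Hellman on the `2`-part, Kranakis Thm. 1.15/1.18), `12100 (N+1)⁴` steps.
* `impl_votes`, `impl_select` — the `m` votes (`impl_forEach`) and the majority selection: the
  selector program `selProg` implements `bmSelectC` in `19800 (N+1)⁴` steps.
* `impl_round`, `impl_descent` — one round of Blum–Micali's Lemma 1 descent (Euler test, division
  by `g`, selector) implements `bmRoundC` in `23100 (N+1)⁴` steps, and the `ℓ`-round loop
  (`impl_iterM`) implements `iterM` of `bmDescentStepC` in `23103 (N+1)⁵` steps.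

Method. Straight-line fragments are numeric scripts verified by symbolic execution
(`Com.NS.runs_of_eq`): the side conditions are discharged from `Bnd`, the final register file is
compared register by register (`congr 1; funext r; cases r; simp`). Loops use `runs_loop_count` / `impl_forEach`; queries use
`impl_query` with the builder `buildS` (`runs_buildS`).

The sequels (`BlumMicaliMachine2.lean`, `…3.lean`) treat the candidates and guesses, the output, the
parameter and parsing phases, and assemble `bmOracleAlg_isPolyTime`; the arithmetic lemmas on
the `2`-adic splitting loop below are for the parameter phase (Horner evaluation of `Q` will use
`Com.hornerVal`/`Com.coeffsHL` of `StackUnary.lean`).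

Refactor note (for a librarian): `getD_drop`, `headD_drop`, `length_encodeNat_le_of_lt_two_pow`,
`encodeNat_zero'` are one-line parallels of lemmas in files outside this import closure
(`OFPostA2.getD_drop`, `CircEval.headD_drop`/`AffineHashProgram.headD_drop`,
`Cryptography.length_encodeNat_le_of_lt`, `TokConv.encodeNat_zero'`); they belong upstream in
`BoolEncodings.lean` / `StackBricks.lean` together with the copies noted in
`BlumMicaliAlgorithm.lean`; likewise `Com.Impl.strengthen` (here a `_root_` dot-extension) belongs
next to `Impl.mono`/`Impl.weaken` in `StackOracle.lean`.

## References

* M. Blum, S. Micali, *How to generate cryptographically strong sequences of pseudo-random bits*,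
  SIAM J. Comput. 13 (1984) 850–864, §3.3 (Lemma 1: the descent, Step 3: square roots; Lemma 2:
  the vote; Theorem 3).
* E. Kranakis, *Primality and Cryptography*, Wiley–Teubner 1986, Thm. 1.15 (square roots modulo `p`
  given a non-residue), Thm. 1.18 (Pohlig–Hellman), §4.10.
* D. E. Knuth, *The Art of Computer Programming*, Vol. 2, 3rd ed., 1998, §4.6.3 (binary
  powering). (Not held; standard.)
* T. Nipkow, G. Klein, *Concrete Semantics*, Springer 2014, Ch. 7, 12 (big-step reasoning, symbolic
  execution). (Not held; standard.)
-/

namespace Literature.Computability.Cryptography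
namespace BMMachine

open _root_.Computability Complexity Complexity.Com


/-! ### Bits -/

/-- `bitsToNat` of the list of values of `f` is `Nat.ofBits f`. [folklore] -/
theorem bitsToNat_ofFn : ∀ {k : ℕ} (f : Fin k → Bool), bitsToNat (List.ofFn f) = Nat.ofBits f
  | 0, f => by simp
  | k + 1, f => by
    rw [List.ofFn_succ, bitsToNat_cons, Nat.ofBits_succ, bitsToNat_ofFn]
    simp [Function.comp_def, Nat.add_comm]

/-- Reading `getD` through `drop` (a parallel of `OFPostA2.getD_drop` in
`Cryptography/OrderFindingPostRefine.lean`, whose import closure — Shor's post-processing — is not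
wanted here). [folklore] -/
theorem getD_drop (l : List Bool) (n i : ℕ) : (l.drop n).getD i false = l.getD (n + i) false := by
  simp [List.getD_eq_getElem?_getD, List.getElem?_drop]

/-- The head (default `false`) of a dropped list (a parallel of `CircEval.headD_drop` in
`Complexity/CircuitEvalPrograms.lean`, an unrelated development not imported here). [folklore] -/
theorem headD_drop (l : List Bool) (n : ℕ) : (l.drop n).headD false = l.getD n false := by
  rw [List.getD_eq_getElem?_getD, ← List.head?_drop, List.headD_eq_head?_getD]

/-! ### Stripping the factors of two

(Used by the parameter phase, `BlumMicaliMachine3.lean`: the machine computes the `2`-adic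
decomposition `p - 1 = 2^s t` by this loop.) -/

/-- One step of the `2`-adic splitting loop: halve while even, counting. [Kranakis 1986, Thm. 1.15, Step 1] [folklore] -/
def stripStep (ts : ℕ × ℕ) : ℕ × ℕ := if ts.1 % 2 = 0 then (ts.1 / 2, ts.2 + 1) else ts

/-- The splitting loop from `2^a · u`, `u` odd: after `n ≤ a` steps it is at `(2^(a-n) u, n)`…
[Kranakis 1986, Thm. 1.15, Step 1] [folklore] -/
theorem stripStep_iterate_of_le {u : ℕ} (hu : u % 2 = 1) : ∀ (n a s : ℕ), n ≤ a →
    stripStep^[n] (2 ^ a * u, s) = (2 ^ (a - n) * u, s + n)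
  | 0, a, s, _ => by simp
  | n + 1, a, s, h => by
    obtain ⟨a, rfl⟩ : ∃ a', a = a' + 1 := ⟨a - 1, by omega⟩
    have h2 : 2 ^ (a + 1) * u = 2 * (2 ^ a * u) := by rw [pow_succ]; ring
    rw [Function.iterate_succ_apply, stripStep, if_pos (by simp only [h2]; omega)]
    simp only [h2, Nat.mul_div_cancel_left _ two_pos]
    rw [stripStep_iterate_of_le hu n a (s + 1) (by omega), Nat.add_sub_add_right]
    congr 1; omega

/-- … and it stays at `(u, a)` from then on. [folklore] -/
theorem stripStep_iterate_odd {u : ℕ} (hu : u % 2 = 1) (n s : ℕ) : stripStep^[n] (u, s) = (u, s) := by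
  induction n with
  | zero => rfl
  | succ n ih => rw [Function.iterate_succ_apply, stripStep, if_neg (by omega), ih]

/-- **The splitting loop computes the `2`-adic decomposition of `p - 1`**: `n ≥ s` steps from
`(p - 1, 0)` reach `(bmOddPart p, bmTwoExp p)` (`p ≥ 2`). [Kranakis 1986, Thm. 1.15, Step 1] [folklore] -/
theorem stripStep_iterate_eq {p n : ℕ} (hp : 2 ≤ p) (hn : bmTwoExp p ≤ n) :
    stripStep^[n] (p - 1, 0) = (bmOddPart p, bmTwoExp p) := by
  have hu : bmOddPart p % 2 = 1 := Nat.two_dvd_ne_zero.1 (not_two_dvd_bmOddPart hp)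
  obtain ⟨d, rfl⟩ := Nat.exists_eq_add_of_le hn
  rw [← two_pow_bmTwoExp_mul_bmOddPart p, add_comm, Function.iterate_add_apply,
    stripStep_iterate_of_le hu _ _ 0 le_rfl, Nat.sub_self, pow_zero, one_mul, zero_add, stripStep_iterate_odd hu]

/-- `s = bmTwoExp p < |p|`. [folklore] -/
theorem bmTwoExp_lt_size {p : ℕ} (hp : 2 ≤ p) : bmTwoExp p < p.size := by
  have h1 : 2 ^ bmTwoExp p ≤ p - 1 := by
    have := two_pow_bmTwoExp_mul_bmOddPart p
    have hpos := bmOddPart_pos hp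
    calc 2 ^ bmTwoExp p ≤ 2 ^ bmTwoExp p * bmOddPart p := Nat.le_mul_of_pos_right _ hpos
      _ = p - 1 := this
  have h2 : p - 1 < 2 ^ p.size := lt_of_lt_of_le (Nat.sub_lt (by omega) one_pos) (Nat.lt_size_self p).le
  exact (Nat.pow_lt_pow_iff_right (by norm_num)).1 (lt_of_le_of_lt h1 h2)

/-- `2^s ≤ p - 1`. [folklore] -/
theorem two_pow_bmTwoExp_le {p : ℕ} (hp : 2 ≤ p) : 2 ^ bmTwoExp p ≤ p - 1 := by
  have := two_pow_bmTwoExp_mul_bmOddPart p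
  calc 2 ^ bmTwoExp p ≤ 2 ^ bmTwoExp p * bmOddPart p := Nat.le_mul_of_pos_right _ (bmOddPart_pos hp)
    _ = p - 1 := this

/-! ### Modular arithmetic rearrangements (machine form = mathematical form)

(`ph2_test_eq` serves the square root below; `mul_pow_mod_mod` serves the candidate phase of
`BlumMicaliMachine2.lean`.) -/

/-- `y · ((b mod p)^e mod p) ≡ y · b^e (mod p)`. [folklore] -/
theorem mul_pow_mod_mod (y b e p : ℕ) : y * ((b % p) ^ e % p) % p = y * b ^ e % p := by
  rw [← Nat.pow_mod, Nat.mul_mod_mod]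

/-- The Pohlig–Hellman test in machine order equals the test as written in `bmPH2`. [folklore] -/
theorem ph2_test_eq (E zinv D N p : ℕ) :
    ((zinv ^ D % p) * E % p) ^ N % p = (E * zinv ^ D) ^ N % p := by
  rw [← Nat.pow_mod, mul_comm (zinv ^ D % p), Nat.pow_mod, Nat.mul_mod_mod, ← Nat.pow_mod]

/-! ### Sizes -/

/-- `|encodeNat x| ≤ n` as soon as `x < 2^n` (the statement of
`Literature.Computability.Cryptography.length_encodeNat_le_of_lt` of `ShorClassicalOracle.lean`, whose
import closure — Shor's assembly — is not wanted here; one line over `TM2Pass.length_encodeNat_eq_size`).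
[folklore] -/
theorem length_encodeNat_le_of_lt_two_pow {x n : ℕ} (h : x < 2 ^ n) : (encodeNat x).length ≤ n := by
  rw [TM2Pass.length_encodeNat_eq_size]; exact Nat.size_le.2 h


/-! ### The register banks

Generated boilerplate (`gen/gen_banks.py` in the session folder of the literature-prover). -/

/-- The constants bank of the Blum–Micali machine: registers written by the parameter phase and
only read afterwards. [folklore] -/
inductive BC where
  | P | G | Y | GI | H | GH | PM | ONE | TWO | Q | M | MU | K | KU | S | L | LU | OD | EXH | ZI | CSU | PW2
  deriving DecidableEq, Fintype, Repr

/-- The variables bank of the Blum–Micali machine: input, coins, loop counters, loop state,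
scratch numerals and flags. [folklore] -/
inductive BV where
  | INP | R | CI | I | W | BEST | FND | CAND | CT | E | ACC | TP | EU | FB | F1 | EE | D | P2I | PW | CS | T1 | T2 | T3 | FQ | X | CJ | CNT | C2 | FM | CK | TMP | BITS | RS | QT | CB | FC | EX | Z | A | FA1 | FA2 | QB | GT | FT | LT
  deriving DecidableEq, Fintype, Repr

/-- The values held by the constants bank (numerals; `mu`, `ku`, `lu`, `csu` are the lengths of
the unary counters `MU`, `KU`, `LU`, `CSU`). [folklore] -/
structure Consts where
  /-- value of register `P` -/
  p : ℕ
  /-- value of register `G` -/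
  g : ℕ
  /-- value of register `Y` -/
  y : ℕ
  /-- value of register `GI` -/
  gi : ℕ
  /-- value of register `H` -/
  h : ℕ
  /-- value of register `GH` -/
  gh : ℕ
  /-- value of register `PM` -/
  pm : ℕ
  /-- value of register `ONE` -/
  one : ℕ
  /-- value of register `TWO` -/
  two : ℕ
  /-- value of register `Q` -/
  q : ℕ
  /-- value of register `M` -/
  m : ℕ
  /-- value of register `MU` -/
  mu : ℕ
  /-- value of register `K` -/
  k : ℕ
  /-- value of register `KU` -/
  ku : ℕ
  /-- value of register `S` -/
  s : ℕ
  /-- value of register `L` -/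
  l : ℕ
  /-- value of register `LU` -/
  lu : ℕ
  /-- value of register `OD` -/
  od : ℕ
  /-- value of register `EXH` -/
  exh : ℕ
  /-- value of register `ZI` -/
  zi : ℕ
  /-- value of register `CSU` -/
  csu : ℕ
  /-- value of register `PW2` -/
  pw2 : ℕ
  deriving DecidableEq

/-- The typed contents of the stateful registers of the variables bank between two fragments:
numerals (`ℕ`, held as `encodeNat`), flags (`Bool`, held as `flag`) and raw bit strings; every
other register of the bank is empty between fragments. [folklore] -/
structure Vars where
  /-- contents of register `R` -/
  r : List Bool
  /-- contents of register `CI` -/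
  ci : List Bool
  /-- contents of register `I` -/
  i : ℕ
  /-- contents of register `BEST` -/
  best : ℕ
  /-- contents of register `FND` -/
  fnd : Bool
  /-- contents of register `CT` -/
  ct : List Bool
  /-- contents of register `E` -/
  e : ℕ
  /-- contents of register `ACC` -/
  acc : ℕ
  /-- contents of register `TP` -/
  tp : ℕ
  /-- contents of register `F1` -/
  f1 : Bool
  /-- contents of register `EE` -/
  ee : ℕ
  /-- contents of register `D` -/
  d : ℕ
  /-- contents of register `P2I` -/
  p2i : ℕ
  /-- contents of register `PW` -/
  pw : ℕ
  /-- contents of register `X` -/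
  x : ℕ
  /-- contents of register `CJ` -/
  cj : List Bool
  /-- contents of register `CNT` -/
  cnt : ℕ
  deriving DecidableEq

/-- The register file of the constants bank holding `c`. [folklore] -/
def encC (c : Consts) : Regs BC
  | .P => encodeNat c.p
  | .G => encodeNat c.g
  | .Y => encodeNat c.y
  | .GI => encodeNat c.gi
  | .H => encodeNat c.h
  | .GH => encodeNat c.gh
  | .PM => encodeNat c.pm
  | .ONE => encodeNat c.one
  | .TWO => encodeNat c.two
  | .Q => encodeNat c.q
  | .M => encodeNat c.m
  | .MU => List.replicate c.mu true
  | .K => encodeNat c.k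
  | .KU => List.replicate c.ku true
  | .S => encodeNat c.s
  | .L => encodeNat c.l
  | .LU => List.replicate c.lu true
  | .OD => encodeNat c.od
  | .EXH => encodeNat c.exh
  | .ZI => encodeNat c.zi
  | .CSU => List.replicate c.csu true
  | .PW2 => encodeNat c.pw2

/-- The register file of the variables bank holding `v` (scratch registers empty). [folklore] -/
def encV (v : Vars) : Regs BV
  | .INP => []
  | .R => v.r
  | .CI => v.ci
  | .I => encodeNat v.i
  | .W => []
  | .BEST => encodeNat v.best
  | .FND => flag v.fnd
  | .CAND => []
  | .CT => v.ct
  | .E => encodeNat v.e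
  | .ACC => encodeNat v.acc
  | .TP => encodeNat v.tp
  | .EU => []
  | .FB => []
  | .F1 => flag v.f1
  | .EE => encodeNat v.ee
  | .D => encodeNat v.d
  | .P2I => encodeNat v.p2i
  | .PW => encodeNat v.pw
  | .CS => []
  | .T1 => []
  | .T2 => []
  | .T3 => []
  | .FQ => []
  | .X => encodeNat v.x
  | .CJ => v.cj
  | .CNT => encodeNat v.cnt
  | .C2 => []
  | .FM => []
  | .CK => []
  | .TMP => []
  | .BITS => []
  | .RS => []
  | .QT => []
  | .CB => []
  | .FC => []
  | .EX => []
  | .Z => []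
  | .A => []
  | .FA1 => []
  | .FA2 => []
  | .QB => []
  | .GT => []
  | .FT => []
  | .LT => []

section EncLemmas

variable (c : Consts) (v : Vars)

/-- Reading `P`. [folklore] -/ @[simp] theorem encC_P : encC c .P = encodeNat c.p := rfl
/-- Reading `G`. [folklore] -/ @[simp] theorem encC_G : encC c .G = encodeNat c.g := rfl
/-- Reading `Y`. [folklore] -/ @[simp] theorem encC_Y : encC c .Y = encodeNat c.y := rfl
/-- Reading `GI`. [folklore] -/ @[simp] theorem encC_GI : encC c .GI = encodeNat c.gi := rfl
/-- Reading `H`. [folklore] -/ @[simp] theorem encC_H : encC c .H = encodeNat c.h := rfl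
/-- Reading `GH`. [folklore] -/ @[simp] theorem encC_GH : encC c .GH = encodeNat c.gh := rfl
/-- Reading `PM`. [folklore] -/ @[simp] theorem encC_PM : encC c .PM = encodeNat c.pm := rfl
/-- Reading `ONE`. [folklore] -/ @[simp] theorem encC_ONE : encC c .ONE = encodeNat c.one := rfl
/-- Reading `TWO`. [folklore] -/ @[simp] theorem encC_TWO : encC c .TWO = encodeNat c.two := rfl
/-- Reading `Q`. [folklore] -/ @[simp] theorem encC_Q : encC c .Q = encodeNat c.q := rfl
/-- Reading `M`. [folklore] -/ @[simp] theorem encC_M : encC c .M = encodeNat c.m := rfl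
/-- Reading `MU`. [folklore] -/ @[simp] theorem encC_MU : encC c .MU = List.replicate c.mu true := rfl
/-- Reading `K`. [folklore] -/ @[simp] theorem encC_K : encC c .K = encodeNat c.k := rfl
/-- Reading `KU`. [folklore] -/ @[simp] theorem encC_KU : encC c .KU = List.replicate c.ku true := rfl
/-- Reading `S`. [folklore] -/ @[simp] theorem encC_S : encC c .S = encodeNat c.s := rfl
/-- Reading `L`. [folklore] -/ @[simp] theorem encC_L : encC c .L = encodeNat c.l := rfl
/-- Reading `LU`. [folklore] -/ @[simp] theorem encC_LU : encC c .LU = List.replicate c.lu true := rfl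
/-- Reading `OD`. [folklore] -/ @[simp] theorem encC_OD : encC c .OD = encodeNat c.od := rfl
/-- Reading `EXH`. [folklore] -/ @[simp] theorem encC_EXH : encC c .EXH = encodeNat c.exh := rfl
/-- Reading `ZI`. [folklore] -/ @[simp] theorem encC_ZI : encC c .ZI = encodeNat c.zi := rfl
/-- Reading `CSU`. [folklore] -/ @[simp] theorem encC_CSU : encC c .CSU = List.replicate c.csu true := rfl
/-- Reading `PW2`. [folklore] -/ @[simp] theorem encC_PW2 : encC c .PW2 = encodeNat c.pw2 := rfl

/-- Reading `INP`. [folklore] -/ @[simp] theorem encV_INP : encV v .INP = [] := rfl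
/-- Reading `R`. [folklore] -/ @[simp] theorem encV_R : encV v .R = v.r := rfl
/-- Reading `CI`. [folklore] -/ @[simp] theorem encV_CI : encV v .CI = v.ci := rfl
/-- Reading `I`. [folklore] -/ @[simp] theorem encV_I : encV v .I = encodeNat v.i := rfl
/-- Reading `W`. [folklore] -/ @[simp] theorem encV_W : encV v .W = [] := rfl
/-- Reading `BEST`. [folklore] -/ @[simp] theorem encV_BEST : encV v .BEST = encodeNat v.best := rfl
/-- Reading `FND`. [folklore] -/ @[simp] theorem encV_FND : encV v .FND = flag v.fnd := rfl
/-- Reading `CAND`. [folklore] -/ @[simp] theorem encV_CAND : encV v .CAND = [] := rfl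
/-- Reading `CT`. [folklore] -/ @[simp] theorem encV_CT : encV v .CT = v.ct := rfl
/-- Reading `E`. [folklore] -/ @[simp] theorem encV_E : encV v .E = encodeNat v.e := rfl
/-- Reading `ACC`. [folklore] -/ @[simp] theorem encV_ACC : encV v .ACC = encodeNat v.acc := rfl
/-- Reading `TP`. [folklore] -/ @[simp] theorem encV_TP : encV v .TP = encodeNat v.tp := rfl
/-- Reading `EU`. [folklore] -/ @[simp] theorem encV_EU : encV v .EU = [] := rfl
/-- Reading `FB`. [folklore] -/ @[simp] theorem encV_FB : encV v .FB = [] := rfl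
/-- Reading `F1`. [folklore] -/ @[simp] theorem encV_F1 : encV v .F1 = flag v.f1 := rfl
/-- Reading `EE`. [folklore] -/ @[simp] theorem encV_EE : encV v .EE = encodeNat v.ee := rfl
/-- Reading `D`. [folklore] -/ @[simp] theorem encV_D : encV v .D = encodeNat v.d := rfl
/-- Reading `P2I`. [folklore] -/ @[simp] theorem encV_P2I : encV v .P2I = encodeNat v.p2i := rfl
/-- Reading `PW`. [folklore] -/ @[simp] theorem encV_PW : encV v .PW = encodeNat v.pw := rfl
/-- Reading `CS`. [folklore] -/ @[simp] theorem encV_CS : encV v .CS = [] := rfl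
/-- Reading `T1`. [folklore] -/ @[simp] theorem encV_T1 : encV v .T1 = [] := rfl
/-- Reading `T2`. [folklore] -/ @[simp] theorem encV_T2 : encV v .T2 = [] := rfl
/-- Reading `T3`. [folklore] -/ @[simp] theorem encV_T3 : encV v .T3 = [] := rfl
/-- Reading `FQ`. [folklore] -/ @[simp] theorem encV_FQ : encV v .FQ = [] := rfl
/-- Reading `X`. [folklore] -/ @[simp] theorem encV_X : encV v .X = encodeNat v.x := rfl
/-- Reading `CJ`. [folklore] -/ @[simp] theorem encV_CJ : encV v .CJ = v.cj := rfl
/-- Reading `CNT`. [folklore] -/ @[simp] theorem encV_CNT : encV v .CNT = encodeNat v.cnt := rfl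
/-- Reading `C2`. [folklore] -/ @[simp] theorem encV_C2 : encV v .C2 = [] := rfl
/-- Reading `FM`. [folklore] -/ @[simp] theorem encV_FM : encV v .FM = [] := rfl
/-- Reading `CK`. [folklore] -/ @[simp] theorem encV_CK : encV v .CK = [] := rfl
/-- Reading `TMP`. [folklore] -/ @[simp] theorem encV_TMP : encV v .TMP = [] := rfl
/-- Reading `BITS`. [folklore] -/ @[simp] theorem encV_BITS : encV v .BITS = [] := rfl
/-- Reading `RS`. [folklore] -/ @[simp] theorem encV_RS : encV v .RS = [] := rfl
/-- Reading `QT`. [folklore] -/ @[simp] theorem encV_QT : encV v .QT = [] := rfl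
/-- Reading `CB`. [folklore] -/ @[simp] theorem encV_CB : encV v .CB = [] := rfl
/-- Reading `FC`. [folklore] -/ @[simp] theorem encV_FC : encV v .FC = [] := rfl
/-- Reading `EX`. [folklore] -/ @[simp] theorem encV_EX : encV v .EX = [] := rfl
/-- Reading `Z`. [folklore] -/ @[simp] theorem encV_Z : encV v .Z = [] := rfl
/-- Reading `A`. [folklore] -/ @[simp] theorem encV_A : encV v .A = [] := rfl
/-- Reading `FA1`. [folklore] -/ @[simp] theorem encV_FA1 : encV v .FA1 = [] := rfl
/-- Reading `FA2`. [folklore] -/ @[simp] theorem encV_FA2 : encV v .FA2 = [] := rfl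
/-- Reading `QB`. [folklore] -/ @[simp] theorem encV_QB : encV v .QB = [] := rfl
/-- Reading `GT`. [folklore] -/ @[simp] theorem encV_GT : encV v .GT = [] := rfl
/-- Reading `FT`. [folklore] -/ @[simp] theorem encV_FT : encV v .FT = [] := rfl
/-- Reading `LT`. [folklore] -/ @[simp] theorem encV_LT : encV v .LT = [] := rfl

end EncLemmas

/-! ### States of the machine -/

/-- `encodeNat 0 = []`, as a `simp` lemma for this development (the same one-liner exists as
`TokConv.encodeNat_zero'` in `Complexity/TokenStreams.lean` and privately in `StackNumeric.lean`;
neither is importable/visible here). [folklore] -/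
@[simp] theorem encodeNat_zero' : encodeNat 0 = [] := rfl

/-- `encodeNat 1 = [true]`. [folklore] -/
@[simp] theorem encodeNat_one' : encodeNat 1 = [true] := rfl

/-- A flag register holds `[]` or `[true]`. [folklore] -/
@[simp] theorem flag_nil_or (b : Bool) : flag b = [] ∨ flag b = [true] := by cases b <;> simp

/-- `¬a ∨ a` (the form `simp` gives to "the flag register holds a flag": the side condition of
`NOp.not`). A `local simp` lemma in this file and its sequels only. [folklore] -/
theorem not_or_self_iff' (a : Prop) : (¬a ∨ a) ↔ True := by
  by_cases h : a <;> simp [h]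

attribute [local simp] not_or_self_iff'

/-- The outer register bank of the machine: the answer bank of `StackOracle.lean` and the two
user banks. [folklore] -/
abbrev O : Type := Complexity.QReg ⊕ (BC ⊕ BV)

/-- Name of a constants-bank register in the outer bank. [folklore] -/
@[reducible] def cc (r : BC) : O := Sum.inr (Sum.inl r)

/-- Name of a variables-bank register in the outer bank. [folklore] -/
@[reducible] def vv (r : BV) : O := Sum.inr (Sum.inr r)

/-- The user bank holding constants `c` and variables `v`. [folklore] -/
def encSt (c : Consts) (v : Vars) : Regs (BC ⊕ BV) := Sum.elim (encC c) (encV v)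

/-- Reading a constant. [folklore] -/
@[simp] theorem encSt_inl (c : Consts) (v : Vars) (r : BC) : encSt c v (Sum.inl r) = encC c r := rfl

/-- Reading a variable. [folklore] -/
@[simp] theorem encSt_inr (c : Consts) (v : Vars) (r : BV) : encSt c v (Sum.inr r) = encV v r := rfl

/-- The machine state with raw answers `σ`, constants `c`, variables `v`, all scratch clean.
[folklore] -/
abbrev st (σ : List Bool × List Bool) (c : Consts) (v : Vars) : Regs (EReg ⊕ O) := qst σ (encSt c v)

/-- Loading the guess counter. [folklore] -/
@[simp] theorem update_encSt_CI (c : Consts) (v : Vars) (w : List Bool) :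
    Function.update (encSt c v) (Sum.inr .CI) w = encSt c { v with ci := w } := by
  funext r; rcases r with r | r
  · simp
  · cases r <;> simp

/-- Loading the round counter. [folklore] -/
@[simp] theorem update_encSt_CT (c : Consts) (v : Vars) (w : List Bool) :
    Function.update (encSt c v) (Sum.inr .CT) w = encSt c { v with ct := w } := by
  funext r; rcases r with r | r
  · simp
  · cases r <;> simp

/-- Loading the vote counter. [folklore] -/
@[simp] theorem update_encSt_CJ (c : Consts) (v : Vars) (w : List Bool) :
    Function.update (encSt c v) (Sum.inr .CJ) w = encSt c { v with cj := w } := by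
  funext r; rcases r with r | r
  · simp
  · cases r <;> simp

/-! ### The constants of an instance and the size bound -/

/-- The constants of the instance `(p, g, y)` for the advantage polynomial `Q`: the parsed
numbers, `g⁻¹ = g^{p-2}`, `h = (p-1)/2`, `g^h`, `p - 1`, `1`, `2`, `q = Q(|p|)`, `m`, `k`, `S`,
`ℓ = |p|`, the `2`-adic decomposition `p - 1 = 2^s t`, `(t+1)/2`, `z⁻¹ = g^{p-1-t}`, `s`, `2^s`.
[Blum–Micali 1984, §3.3, proof of Theorem 3] [folklore] -/
def mkC (Q : Polynomial ℕ) (p g y : ℕ) : Consts where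
  p := p
  g := g
  y := y
  gi := g ^ (p - 2) % p
  h := (p - 1) / 2
  gh := g ^ ((p - 1) / 2) % p
  pm := p - 1
  one := 1
  two := 2
  q := bmQ Q p
  m := bmM Q p
  mu := bmM Q p
  k := bmK Q p
  ku := bmK Q p
  s := bmSeg Q p
  l := p.size
  lu := p.size
  od := bmOddPart p
  exh := (bmOddPart p + 1) / 2
  zi := g ^ (p - 1 - bmOddPart p) % p
  csu := bmTwoExp p
  pw2 := 2 ^ bmTwoExp p

section MkC
variable (Q : Polynomial ℕ) (p g y : ℕ)
/-- The constant `p`. [folklore] -/ @[simp] theorem mkC_p : (mkC Q p g y).p = p := rfl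
/-- The constant `g`. [folklore] -/ @[simp] theorem mkC_g : (mkC Q p g y).g = g := rfl
/-- The constant `y`. [folklore] -/ @[simp] theorem mkC_y : (mkC Q p g y).y = y := rfl
/-- The constant `g⁻¹ = g^{p-2} mod p`. [folklore] -/ @[simp] theorem mkC_gi : (mkC Q p g y).gi = g ^ (p - 2) % p := rfl
/-- The constant `h = (p-1)/2`. [folklore] -/ @[simp] theorem mkC_h : (mkC Q p g y).h = (p - 1) / 2 := rfl
/-- The constant `g^h mod p`. [folklore] -/ @[simp] theorem mkC_gh : (mkC Q p g y).gh = g ^ ((p - 1) / 2) % p := rfl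
/-- The constant `p - 1`. [folklore] -/ @[simp] theorem mkC_pm : (mkC Q p g y).pm = p - 1 := rfl
/-- The constant `1`. [folklore] -/ @[simp] theorem mkC_one : (mkC Q p g y).one = 1 := rfl
/-- The constant `2`. [folklore] -/ @[simp] theorem mkC_two : (mkC Q p g y).two = 2 := rfl
/-- The constant `q = Q(|p|)`. [folklore] -/ @[simp] theorem mkC_q : (mkC Q p g y).q = bmQ Q p := rfl
/-- The constant `m`. [folklore] -/ @[simp] theorem mkC_m : (mkC Q p g y).m = bmM Q p := rfl
/-- The constant `m` (unary). [folklore] -/ @[simp] theorem mkC_mu : (mkC Q p g y).mu = bmM Q p := rfl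
/-- The constant `k`. [folklore] -/ @[simp] theorem mkC_k : (mkC Q p g y).k = bmK Q p := rfl
/-- The constant `k` (unary). [folklore] -/ @[simp] theorem mkC_ku : (mkC Q p g y).ku = bmK Q p := rfl
/-- The constant the segment length `S`. [folklore] -/ @[simp] theorem mkC_s : (mkC Q p g y).s = bmSeg Q p := rfl
/-- The constant `ℓ = |p|`. [folklore] -/ @[simp] theorem mkC_l : (mkC Q p g y).l = p.size := rfl
/-- The constant `ℓ` (unary). [folklore] -/ @[simp] theorem mkC_lu : (mkC Q p g y).lu = p.size := rfl
/-- The constant the odd part `t` of `p - 1`. [folklore] -/ @[simp] theorem mkC_od : (mkC Q p g y).od = bmOddPart p := rfl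
/-- The constant `(t+1)/2`. [folklore] -/ @[simp] theorem mkC_exh : (mkC Q p g y).exh = (bmOddPart p + 1) / 2 := rfl
/-- The constant `z⁻¹ = g^{p-1-t} mod p`. [folklore] -/ @[simp] theorem mkC_zi : (mkC Q p g y).zi = g ^ (p - 1 - bmOddPart p) % p := rfl
/-- The constant `s`, the exponent of `2` in `p - 1` (unary). [folklore] -/ @[simp] theorem mkC_csu : (mkC Q p g y).csu = bmTwoExp p := rfl
/-- The constant `2^s`. [folklore] -/ @[simp] theorem mkC_pw2 : (mkC Q p g y).pw2 = 2 ^ bmTwoExp p := rfl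
end MkC

/-- **The size bound.** `Bnd Q p g y N`: the instance passes the guard (`p > 2`, `0 < g < p`,
`y < p`) and `N` dominates the lengths of all numerals the machine forms (residues and small
multiples of `p`, candidates `≤ 4p + 2qS`), the values of its unary counters (`m`, `k`, `ℓ`,
`2q ≤ 48(ℓ+1)(q+1)²`) and the length of a query. (The fields `g_pos`, `y_lt` and the `2qS` part
of `lenC` are first used by the candidate/output phase of `BlumMicaliMachine2.lean`.) [folklore] -/
structure Bnd (Q : Polynomial ℕ) (p g y N : ℕ) : Prop where
  two_lt : 2 < p
  g_pos : 0 < g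
  g_lt : g < p
  y_lt : y < p
  lenC : ∀ x, x ≤ 4 * p + 2 * bmQ Q p * bmSeg Q p → (encodeNat x).length ≤ N
  valM : 48 * (p.size + 1) * (bmQ Q p + 1) ^ 2 ≤ N
  rawQ : 5 * (encodeNat p).length + 4 ≤ N

namespace Bnd

variable {Q : Polynomial ℕ} {p g y N : ℕ} (hB : Bnd Q p g y N)
include hB

/-- `p > 0`. [folklore] -/
theorem p_pos : 0 < p := by have := hB.two_lt; omega
/-- `p > 1`. [folklore] -/
theorem one_lt : 1 < p := by have := hB.two_lt; omega
/-- `p ≥ 2`. [folklore] -/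
theorem two_le : 2 ≤ p := hB.two_lt.le
/-- `h = (p-1)/2 > 0`. [folklore] -/
theorem h_pos : 0 < (p - 1) / 2 := by have := hB.two_lt; omega
/-- `h < p`. [folklore] -/
theorem h_lt : (p - 1) / 2 < p := by have := hB.two_lt; omega
/-- Residue-sized numbers have short numerals. [folklore] -/
theorem lenR {x : ℕ} (hx : x ≤ 4 * p) : (encodeNat x).length ≤ N := hB.lenC x (by omega)
/-- Residues have short numerals. [folklore] -/
theorem len_lt {x : ℕ} (hx : x < p) : (encodeNat x).length ≤ N := hB.lenR (by omega)
/-- Numbers up to `p` have short numerals. [folklore] -/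
theorem len_le {x : ℕ} (hx : x ≤ p) : (encodeNat x).length ≤ N := hB.lenR (by omega)
/-- Remainders mod `p` have short numerals. [folklore] -/
theorem len_mod (x : ℕ) : (encodeNat (x % p)).length ≤ N := hB.len_lt (Nat.mod_lt _ hB.p_pos)
/-- `p` has a short numeral. [folklore] -/
theorem len_p : (encodeNat p).length ≤ N := hB.len_le le_rfl
/-- `N ≥ 1`. [folklore] -/
theorem one_le_N : 1 ≤ N := le_trans (by decide) (hB.len_le (x := 1) hB.one_lt.le)
/-- `N ≥ 2`. [folklore] -/
theorem two_le_N : 2 ≤ N := le_trans (by decide) (hB.len_le (x := 2) hB.two_le)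
/-- Counter values are at most `N`. [folklore] -/
theorem valM' {x : ℕ} (hx : x ≤ 48 * (p.size + 1) * (bmQ Q p + 1) ^ 2) : x ≤ N := hx.trans hB.valM
/-- `q ≤ N`. [folklore] -/
theorem q_le : bmQ Q p ≤ N := hB.valM' (by nlinarith [Nat.zero_le (p.size), Nat.zero_le (bmQ Q p)])
/-- `2q ≤ N`. [folklore] -/
theorem two_q_le : 2 * bmQ Q p ≤ N := hB.valM' (by nlinarith [Nat.zero_le (p.size), Nat.zero_le (bmQ Q p)])
/-- `ℓ ≤ N`. [folklore] -/
theorem l_le : p.size ≤ N := by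
  refine hB.valM' ?_
  have h1 : 1 ≤ (bmQ Q p + 1) ^ 2 := Nat.one_le_pow _ _ (Nat.succ_pos _)
  calc p.size ≤ 48 * (p.size + 1) * 1 := by omega
    _ ≤ 48 * (p.size + 1) * (bmQ Q p + 1) ^ 2 := Nat.mul_le_mul_left _ h1
/-- `m ≤ N`. [folklore] -/
theorem m_le : bmM Q p ≤ N := hB.valM' (by unfold bmM; nlinarith [Nat.zero_le (p.size), Nat.zero_le (bmQ Q p)])
/-- `2m ≤ N`. [folklore] -/
theorem two_m_le : 2 * bmM Q p ≤ N := hB.valM' (by unfold bmM; nlinarith [Nat.zero_le (p.size), Nat.zero_le (bmQ Q p)])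
/-- `k ≤ N`. [folklore] -/
theorem k_le : bmK Q p ≤ N := by
  refine hB.valM' ?_
  unfold bmK
  have h0 : (bmQ Q p + 1).size ≤ bmQ Q p + 1 := Nat.size_le.2 Nat.lt_two_pow_self
  have h1 : bmQ Q p + 1 ≤ (bmQ Q p + 1) ^ 2 := by rw [pow_two]; exact Nat.le_mul_of_pos_left _ (Nat.succ_pos _)
  have h2 : p.size + (bmQ Q p + 1) ≤ (p.size + 1) * (bmQ Q p + 1) ^ 2 := by nlinarith
  calc p.size + (bmQ Q p + 1).size ≤ p.size + (bmQ Q p + 1) := by omega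
    _ ≤ (p.size + 1) * (bmQ Q p + 1) ^ 2 := h2
    _ ≤ 48 * (p.size + 1) * (bmQ Q p + 1) ^ 2 := by nlinarith
/-- `s < ℓ`. [folklore] -/
theorem s_lt_l : bmTwoExp p < p.size := bmTwoExp_lt_size hB.two_le
/-- `s ≤ N`. [folklore] -/
theorem s_le : bmTwoExp p ≤ N := hB.s_lt_l.le.trans hB.l_le
/-- `2^s ≤ p - 1`. [folklore] -/
theorem two_pow_s_le : 2 ^ bmTwoExp p ≤ p - 1 := two_pow_bmTwoExp_le hB.two_le
/-- `2^ℓ ≤ 2p`. [folklore] -/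
theorem two_pow_l_le : 2 ^ p.size ≤ 2 * p := by
  have h := Nat.lt_size_self p
  have h0 : 0 < p.size := Nat.size_pos.2 hB.p_pos
  have : 2 ^ (p.size - 1) ≤ p := by
    by_contra hc
    have := Nat.size_le.2 (not_le.1 hc)
    omega
  calc 2 ^ p.size = 2 * 2 ^ (p.size - 1) := by rw [← pow_succ']; congr 1; omega
    _ ≤ 2 * p := by omega

end Bnd

/-- Numbers up to `N` have numerals of length at most `N`. [folklore] -/
theorem len_of_le {x N : ℕ} (hx : x ≤ N) : (encodeNat x).length ≤ N := (length_encodeNat_le_self x).trans hx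

/-! ### Reading coin blocks -/

/-- The first `j` bits of `rr`, padded with `false` (what `j` pops with `popTo` read).
[folklore] -/
def readBits (rr : List Bool) (j : ℕ) : List Bool := List.ofFn fun s : Fin j => rr.getD s false

/-- No bit read. [folklore] -/
@[simp] theorem readBits_zero (rr : List Bool) : readBits rr 0 = [] := rfl

/-- `getD` through `tail`. [folklore] -/
theorem getD_tail (l : List Bool) (i : ℕ) : l.tail.getD i false = l.getD (i + 1) false := by
  cases l <;> simp

/-- One more bit read. [folklore] -/
theorem readBits_succ (rr : List Bool) (j : ℕ) : readBits rr (j + 1) = rr.headD false :: readBits rr.tail j := by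
  rw [readBits, List.ofFn_succ]
  congr 1
  · cases rr <;> simp
  · simp [readBits]

/-- `j` bits are read. [folklore] -/
@[simp] theorem length_readBits (rr : List Bool) (j : ℕ) : (readBits rr j).length = j := by simp [readBits]

/-- The coin block of `k + 1` coins at position `b₀` of the coin string `r` (junk `false` beyond
its end). [folklore] -/
def blkAt (r : List Bool) (b₀ k : ℕ) : Fin (k + 1) → Bool := fun s => r.getD (b₀ + s) false

/-- The coin blocks of the reduction are the blocks at the positions `bmCoinIdx … 0`. [folklore] -/
theorem bmBlocks_eq_blkAt (r : List Bool) (ℓ m k i : ℕ) (t : Fin ℓ) (j : Fin m) :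
    bmBlocks r ℓ m k i t j = blkAt r (bmCoinIdx ℓ m k i t j 0) k := by
  funext s; simp [bmBlocks, blkAt, bmCoinIdx]

/-- The `k` bits read from the coins at position `b₀` are the number of the block. [folklore] -/
theorem bitsToNat_readBits_drop (r : List Bool) (b₀ k : ℕ) :
    bitsToNat (readBits (r.drop b₀) k) = Nat.ofBits (Fin.init (blkAt r b₀ k)) := by
  rw [readBits, bitsToNat_ofFn]
  congr 1; funext s
  simp [Fin.init, blkAt]

/-- The coin read after the `k` bits is the tie-breaking coin of the block. [folklore] -/
theorem headD_drop_coin (r : List Bool) (b₀ k : ℕ) :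
    (r.drop (b₀ + k)).headD false = bmCoin k (blkAt r b₀ k) := by
  rw [headD_drop]; simp [bmCoin, blkAt]

/-- The bit-reading loop: pop the counter `CK`; per bit, pop a coin onto `TMP`. [folklore] -/
def readLoop : Com (EReg ⊕ O) :=
  loop (Sum.inr (vv .CK)) (NOp.popTo (vv .R) (vv .TMP)).com (NOp.popTo (vv .R) (vv .TMP)).com

/-- **Effect of the bit-reading loop**: with a counter of length `n`, `n` coins move (reversed)
from `R` onto `TMP`, reading `false` past the end of the coins; `5n + 1` steps. [folklore] -/
theorem runs_readLoop (Qf : Regs Complexity.QReg) : ∀ (w : List Bool) (T : Regs (BC ⊕ BV)), T (Sum.inr .CK) = [] →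
    Runs readLoop (base (ust Qf (Function.update T (Sum.inr .CK) w)))
      (base (ust Qf (Function.update (Function.update T (Sum.inr .R) ((T (Sum.inr .R)).drop w.length))
        (Sum.inr .TMP) ((readBits (T (Sum.inr .R)) w.length).reverse ++ T (Sum.inr .TMP)))))
      (5 * w.length + 1)
  | [], T, hT => by
    have e1 : Function.update T (Sum.inr BV.CK) [] = T := by rw [← hT]; exact Function.update_eq_self _ _
    have e2 : Function.update (Function.update T (Sum.inr BV.R) (T (Sum.inr .R))) (Sum.inr BV.TMP) (T (Sum.inr .TMP)) = T := by
      rw [Function.update_eq_self]; exact Function.update_eq_self _ _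
    simp only [List.length_nil, List.drop_zero, readBits_zero, List.reverse_nil, List.nil_append, e1, e2]
    exact (Runs.loop_nil _ _ (by simp [hT])).mono (by norm_num)
  | b :: w, T, hT => by
    -- one iteration: pop a coin onto `TMP`
    set T₁ := Function.update (Function.update T (Sum.inr .R) (T (Sum.inr .R)).tail) (Sum.inr .TMP)
      ((T (Sum.inr .R)).headD false :: T (Sum.inr .TMP)) with hT₁
    have hT₁K : T₁ (Sum.inr .CK) = [] := by simp [T₁, hT]
    have hbody : Runs (NOp.popTo (vv .R) (vv .TMP)).com (base (ust Qf (Function.update T (Sum.inr .CK) w)))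
        (base (ust Qf (Function.update T₁ (Sum.inr .CK) w))) 3 := by
      refine ((NOp.runs_popTo (β := O) (s := vv .R) (d := vv .TMP) (by simp [vv]) (ust Qf (Function.update T (Sum.inr .CK) w))).of_eq ?_ le_rfl)
      simp only [NOp.eval, vv, ust_inr, update_ust_inr]
      congr 1
      simp [T₁, Function.update_comm]
    have ih := runs_readLoop Qf w T₁ hT₁K
    have hk : base (ust Qf (Function.update T (Sum.inr BV.CK) (b :: w))) (Sum.inr (vv .CK)) = b :: w := by simp [vv]
    have hupd : Function.update (base (ust Qf (Function.update T (Sum.inr BV.CK) (b :: w)))) (Sum.inr (vv .CK)) w =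
        base (ust Qf (Function.update T (Sum.inr .CK) w)) := by simp [vv]
    have efin : Function.update (Function.update T₁ (Sum.inr BV.R) ((T₁ (Sum.inr .R)).drop w.length)) (Sum.inr BV.TMP)
          ((readBits (T₁ (Sum.inr .R)) w.length).reverse ++ T₁ (Sum.inr .TMP)) =
        Function.update (Function.update T (Sum.inr BV.R) ((T (Sum.inr .R)).drop (b :: w).length)) (Sum.inr BV.TMP)
          ((readBits (T (Sum.inr .R)) (b :: w).length).reverse ++ T (Sum.inr .TMP)) := by
      simp only [T₁, List.length_cons, readBits_succ, List.reverse_cons, List.append_assoc, List.singleton_append]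
      funext r
      simp only [Function.update_apply]
      split_ifs <;> simp_all [List.drop_tail]
    rw [← efin]
    cases b
    · exact (Runs.loop_false' hk hupd hbody ih).mono (by simp; omega)
    · exact (Runs.loop_true' hk hupd hbody ih).mono (by simp; omega)

/-! ### Building a query -/

/-- The instance encoding `encodeDLogInstance` (`Shor.lean`), unfolded. [folklore] -/
theorem encodeDLogInstance_eq (p g z : ℕ) :
    encodeDLogInstance p g z = boolPair (encodeNat p) (boolPair (encodeNat g) (encodeNat z)) := by
  simp [encodeDLogInstance, Encoding.pairBool, encodingNatBool]

open NS NOp in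
/-- The query builder: write the encoded triple `(p, g, Z)` into the output register.
[Blum–Micali 1984, §3.3, Theorem 3 (a call `MB[p, g, x]`)] [folklore] -/
def buildS : NS O :=
  ofList [.copy (vv .Z) (vv .QB), .copy (cc .G) (vv .GT), .pairOnto (vv .GT) (vv .QB), .copy (cc .P) (vv .GT),
    .pairOnto (vv .GT) (vv .QB), .move (vv .QB) (Sum.inl .OUT)]

/-- **Effect of the query builder** on any user bank holding `p`, `g` and a residue `z` in `P`,
`G`, `Z` (scratch `QB`, `GT` empty): the query `encodeDLogInstance p g z` appears in `OUT`, the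
user bank is unchanged; `71 (N+1)³` steps. [folklore] -/
theorem runs_buildS {Q : Polynomial ℕ} {p g y N : ℕ} (hB : Bnd Q p g y N) (s : List Bool) (T : Regs (BC ⊕ BV)) {z : ℕ}
    (hP : T (Sum.inl .P) = encodeNat p) (hG : T (Sum.inl .G) = encodeNat g) (hZ : T (Sum.inr .Z) = encodeNat z)
    (hz : z < p) (hQB : T (Sum.inr .QB) = []) (hGT : T (Sum.inr .GT) = []) :
    Runs buildS.com (qs [] s [] [] [] T) (qs [] s [] [] (encodeDLogInstance p g z) T) (71 * (N + 1) ^ 3) := by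
  have hg : (encodeNat g).length ≤ (encodeNat p).length := Brick.length_encodeNat_mono hB.g_lt.le
  have hz' : (encodeNat z).length ≤ (encodeNat p).length := Brick.length_encodeNat_mono hz.le
  have hq := hB.rawQ
  refine NS.runs_of_eq (N := N) buildS _ ?_ ?_ ?_
  · simp [buildS, vv, cc, hP, hG, hZ, hQB, hGT, hB.len_p, hB.len_lt hB.g_lt, hB.len_lt hz]
    omega
  · simp [buildS, vv, cc, hZ, hQB, hGT, hG, hP, encodeDLogInstance_eq]
    congr 1
    funext r
    rcases eq_or_ne r (Sum.inr BV.QB) with rfl | h1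
    · simp [hQB]
    rcases eq_or_ne r (Sum.inr BV.GT) with rfl | h2
    · simp [hGT]
    simp [h1, h2]
  · simp [buildS]

/-! ### The vote -/

open NS NOp in
/-- After the `k` shift bits are on `TMP`: form the shift `r = (bits mod h) + 1`, read the
tie-coin into the flag `FC`, and form the first query point `Z = x g^r mod p`.
[Blum–Micali 1984, §3.3, proof of Lemma 2] [folklore] -/
def voteS1 : NS O :=
  ofList [.pour (vv .TMP) (vv .BITS), .divMod (vv .QT) (vv .RS) (vv .BITS) (cc .H), .succ (vv .RS) (vv .RS),
    .clear (vv .QT), .clear (vv .BITS), .popTo (vv .R) (vv .CB), .isT (vv .CB) (vv .FC),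
    .powMod (vv .T1) (cc .G) (vv .RS) (cc .P), .copy (vv .X) (vv .Z), .mulMod (vv .Z) (vv .T1) (cc .P), .clear (vv .T1)]

open NS NOp in
/-- Form the second query point `Z = x g^{r+h} mod p` and drop the shift. [Blum–Micali 1984, §3.3,
proof of Lemma 2] [folklore] -/
def voteS2 : NS O :=
  ofList [.add (vv .EX) (vv .RS) (cc .H), .powMod (vv .T1) (cc .G) (vv .EX) (cc .P), .clear (vv .Z),
    .copy (vv .X) (vv .Z), .mulMod (vv .Z) (vv .T1) (cc .P), .clear (vv .T1), .clear (vv .EX), .clear (vv .RS)]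

open NS NOp in
/-- The tally: from the two answer flags and the coin flag, count the vote
`if b₁ = b₂ then coin else b₁` into `CNT`, clearing the flags and `Z`. [Blum–Micali 1984, §3.3,
proof of Lemma 2 (`PSQR_i`, counters)] [folklore] -/
def voteS3 : NS O :=
  seq (ite (vv .FA1)
        (ite (vv .FA2) (ite (vv .FC) (op (.succ (vv .CNT) (vv .CNT))) nop)
          (seq (op (.succ (vv .CNT) (vv .CNT))) (op (.clear (vv .FC)))))
        (ite (vv .FA2) (op (.clear (vv .FC))) (ite (vv .FC) (op (.succ (vv .CNT) (vv .CNT))) nop)))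
    (op (.clear (vv .Z)))

/-- **The vote program**: load the bit counter, read the shift bits, `voteS1`, ask the first bit,
`voteS2`, ask the second bit, tally. [Blum–Micali 1984, §3.3, proof of Lemma 2] [folklore] -/
def voteProg : Com (EReg ⊕ O) :=
  (NOp.copy (cc .KU) (vv .CK)).com ;; (readLoop ;; (voteS1.com ;;
    (qAsk (Sum.inr .A) buildS.com ;; ((NOp.isT (vv .A) (vv .FA1)).com ;; (voteS2.com ;;
      (qAsk (Sum.inr .A) buildS.com ;; ((NOp.isT (vv .A) (vv .FA2)).com ;; voteS3.com)))))))

/-- The vote computation as an explicit two-query tree. [folklore] -/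
theorem bmVoteC_eq (p g x r : ℕ) (coin : Bool) :
    bmVoteC p g x r coin =
      OracleComp.query (encodeDLogInstance p g (x * g ^ r % p)) (fun a =>
        OracleComp.query (encodeDLogInstance p g (x * g ^ (r + (p - 1) / 2) % p)) (fun a' =>
          OracleComp.pure (if decide (a = encodeBool true) = decide (a' = encodeBool true) then coin
            else decide (a = encodeBool true)))) := rfl


/-- Reading an answer into a flag: `isT A F` on a bank whose `A` holds the answer `a` sets `F`
to the bit "`a = encodeBool 1`" and empties `A`. [folklore] -/
theorem runs_isT_A {N : ℕ} (F : BV) (hAF : BV.A ≠ F) (σ : List Bool × List Bool) (T : Regs (BC ⊕ BV))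
    (a : List Bool) (ha : a.length ≤ N) (hF : T (Sum.inr F) = []) (hA : T (Sum.inr .A) = []) :
    Runs (NOp.isT (vv .A) (vv F)).com (qst σ (Function.update T (Sum.inr .A) a))
      (qst σ (Function.update T (Sum.inr F) (flag (decide (a = encodeBool true))))) (7 * (N + 1) ^ 3) := by
  have hAF' : (Sum.inr (Sum.inr F) : O) ≠ vv .A := by simp [vv, Ne.symm hAF]
  have e : Function.update T (Sum.inr BV.A) [] = T := by rw [← hA]; exact Function.update_eq_self _ _
  refine NS.runs_of_eq (N := N) (NS.op (NOp.isT (vv .A) (vv F))) _ ?_ ?_ ?_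
  · simp [vv, hAF, ha, hF, hAF.symm]
  · simp [vv, e]
    rfl
  · simp

/-- **Effect of the tally.** [Blum–Micali 1984, §3.3, proof of Lemma 2] [folklore] -/
theorem runs_voteS3 {Q : Polynomial ℕ} {p g y N : ℕ} (hB : Bnd Q p g y N) (σ : List Bool × List Bool) (v₁ : Vars)
    (coin b₁ b₂ : Bool) {z : ℕ} (hz : z < p) (hcnt : v₁.cnt < bmM Q p) :
    Runs voteS3.com
      (qst σ (Function.update (Function.update (Function.update (Function.update (encSt (mkC Q p g y) v₁)
        (Sum.inr .FC) (flag coin)) (Sum.inr .Z) (encodeNat z)) (Sum.inr .FA1) (flag b₁)) (Sum.inr .FA2) (flag b₂)))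
      (qst σ (encSt (mkC Q p g y) { v₁ with cnt := v₁.cnt + (if b₁ = b₂ then coin else b₁).toNat }))
      (82 * (N + 1) ^ 3) := by
  have hc : (encodeNat v₁.cnt).length ≤ N := len_of_le (hcnt.le.trans hB.m_le)
  have hc1 : (encodeNat v₁.cnt).length ≤ N + 1 := hc.trans N.le_succ
  have hlz : (encodeNat z).length ≤ N := hB.len_lt hz
  have h1 := hB.one_le_N
  cases b₁ <;> cases b₂ <;> cases coin <;>
  · refine NS.runs_of_eq (N := N) voteS3 _ ?_ ?_ ?_
    · simp [voteS3, vv, hc, hc1, hlz, h1]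
    · simp [voteS3, vv]
      congr 1; funext r; rcases r with r | r
      · simp
      · cases r <;> simp
    · simp [voteS3]

section Vote

variable {Q : Polynomial ℕ} {p g y N : ℕ}

/-- **The vote program implements one vote** `bmVoteC` cast with the coin block at the current
coin position: it consumes the `k + 1` coins of the block, asks the two bits, and adds the vote
to `CNT`. [Blum–Micali 1984, §3.3, proof of Lemma 2] [folklore] -/
theorem impl_vote (hB : Bnd Q p g y N) {σ : List Bool × List Bool} (hσ : σ.2.length ≤ N) (v : Vars)
    (r₀ : List Bool) (b₀ : ℕ) (hr : v.r = r₀.drop b₀) (hx : v.x < p) (hcnt : v.cnt < bmM Q p) :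
    Impl voteProg
      (bmVoteC p g v.x (bmShift p (bmK Q p) (blkAt r₀ b₀ (bmK Q p))) (bmCoin (bmK Q p) (blkAt r₀ b₀ (bmK Q p))))
      σ (encSt (mkC Q p g y) v)
      (fun b T' => T' = encSt (mkC Q p g y) { v with r := r₀.drop (b₀ + (bmK Q p + 1)), cnt := v.cnt + b.toNat })
      (6600 * (N + 1) ^ 3) := by
  obtain ⟨u, s⟩ := σ
  simp only at hσ
  -- notation
  set rs := bmShift p (bmK Q p) (blkAt r₀ b₀ (bmK Q p)) with hrs
  set coin := bmCoin (bmK Q p) (blkAt r₀ b₀ (bmK Q p)) with hcoin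
  set z₁ := v.x * g ^ rs % p with hz₁
  set z₂ := v.x * g ^ (rs + (p - 1) / 2) % p with hz₂
  set v₁ : Vars := { v with r := r₀.drop (b₀ + (bmK Q p + 1)) } with hv₁
  have hp0 := hB.p_pos
  have hp1 := hB.one_lt
  have hU : N ≤ (N + 1) ^ 3 := le_trans (Nat.le_succ N) (succ_le_cube N)
  have hU1 : 1 ≤ (N + 1) ^ 3 := one_le_cube N
  have hkN : bmK Q p ≤ N := hB.k_le
  have hz₁p : z₁ < p := Nat.mod_lt _ hp0
  have hz₂p : z₂ < p := Nat.mod_lt _ hp0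
  have hrs_le : rs ≤ p := by
    rw [hrs, bmShift]; have := Nat.mod_lt (Nat.ofBits (Fin.init (blkAt r₀ b₀ (bmK Q p)))) hB.h_pos
    have := hB.h_lt; omega
  -- the values formed, in the shape symbolic execution produces them
  have hrs' : Nat.ofBits (Fin.init (blkAt r₀ b₀ (bmK Q p))) % ((p - 1) / 2) + 1 = rs := rfl
  have hcoin' : r₀[b₀ + bmK Q p]?.getD false = coin := by
    simp [hcoin, bmCoin, blkAt, List.getD_eq_getElem?_getD]
  have hmodh : ∀ x, (encodeNat (x % ((p - 1) / 2))).length ≤ N := fun x =>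
    hB.len_lt ((Nat.mod_lt x hB.h_pos).trans hB.h_lt)
  have hmodh1 : ∀ x, (encodeNat (x % ((p - 1) / 2))).length ≤ N + 1 := fun x => (hmodh x).trans N.le_succ
  have hdivh : (encodeNat (Nat.ofBits (Fin.init (blkAt r₀ b₀ (bmK Q p))) / ((p - 1) / 2))).length ≤ N := by
    refine (length_encodeNat_le_of_lt_two_pow ?_).trans hkN
    exact lt_of_le_of_lt (Nat.div_le_self _ _) (Nat.ofBits_lt_two_pow _)
  have h2p : 2 ≤ p - 1 := by have := hB.two_lt; omega
  have hlh : (encodeNat ((p - 1) / 2)).length ≤ N := hB.len_le hB.h_lt.le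
  have hlg : (encodeNat g).length ≤ N := hB.len_lt hB.g_lt
  have hlx : (encodeNat v.x).length ≤ N := hB.len_lt hx
  have hlrs : (encodeNat rs).length ≤ N := hB.len_le hrs_le
  have h1N := hB.one_le_N
  have hlp := hB.len_p
  have hlmod : ∀ x, (encodeNat (x % p)).length ≤ N := hB.len_mod
  -- Stage 0: load the bit counter
  have h0 : Runs (NOp.copy (cc .KU) (vv .CK)).com (st (u, s) (mkC Q p g y) v)
      (qst (u, s) (Function.update (encSt (mkC Q p g y) v) (Sum.inr .CK) (List.replicate (bmK Q p) true)))
      (13 * (N + 1) ^ 3) := by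
    refine NS.runs_of_eq (N := N) (NS.op (NOp.copy (cc .KU) (vv .CK))) _ ?_ ?_ ?_
    · simp [vv, cc, hkN]
    · simp [vv, cc]
    · simp
  -- Stage 1: read `k` coins
  have h1 : Runs readLoop
      (qst (u, s) (Function.update (encSt (mkC Q p g y) v) (Sum.inr .CK) (List.replicate (bmK Q p) true)))
      (qst (u, s) (Function.update (Function.update (encSt (mkC Q p g y) v) (Sum.inr .R) (r₀.drop (b₀ + bmK Q p)))
        (Sum.inr .TMP) (readBits (r₀.drop b₀) (bmK Q p)).reverse)) (6 * (N + 1) ^ 3) := by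
    refine (runs_readLoop (QReg.file u s [] [] []) (List.replicate (bmK Q p) true) (encSt (mkC Q p g y) v)
      (by simp)).of_eq ?_ ?_
    · simp [hr, List.drop_drop]
    · simp only [List.length_replicate]; nlinarith
  -- Stage 2: shift, coin, first query point
  set U3 := Function.update (Function.update (Function.update (encSt (mkC Q p g y) v₁) (Sum.inr .RS) (encodeNat rs))
    (Sum.inr .FC) (flag coin)) (Sum.inr .Z) (encodeNat z₁) with hU3
  have h2 : Runs voteS1.com
      (qst (u, s) (Function.update (Function.update (encSt (mkC Q p g y) v) (Sum.inr .R) (r₀.drop (b₀ + bmK Q p)))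
        (Sum.inr .TMP) (readBits (r₀.drop b₀) (bmK Q p)).reverse))
      (qst (u, s) U3) (3298 * (N + 1) ^ 3) := by
    refine NS.runs_of_eq (N := N) voteS1 _ ?_ ?_ ?_
    · simp [voteS1, vv, cc, bitsToNat_readBits_drop, hrs', hkN, hmodh, hmodh1, hdivh, h2p, hlh, hlg, hlx, hlrs, h1N, hlp,
        hlmod, hp0, hp1]
    · have hz₁' : v.x * g ^ rs % p = z₁ := rfl
      simp [voteS1, vv, cc, bitsToNat_readBits_drop, hrs', hcoin', hU3, hv₁, ← add_assoc, hz₁']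
      congr 1; funext r; rcases r with r | r
      · simp
      · cases r <;> simp
    · simp [voteS1]
  -- the computation as a two-query tree
  rw [bmVoteC_eq]
  have hA3 : U3 (Sum.inr BV.A) = [] := by simp [hU3]
  refine (impl_runs_seq h0 (impl_runs_seq h1 (impl_runs_seq h2
    (impl_query (Sum.inr .A) (B₁ := 71 * (N + 1) ^ 3) (B₂ := 3150 * (N + 1) ^ 3) ?hb1 ?hk1)))).mono ?hm1
  case hm1 =>
    rw [hA3]
    generalize (N + 1) ^ 3 = U at hU hU1 ⊢
    simp only [List.length_nil]
    omega
  case hb1 =>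
    intro hu
    simp only at hu; subst hu
    exact ⟨U3, runs_buildS hB s U3 (by simp [hU3]) (by simp [hU3]) (by simp [hU3, hz₁]) hz₁p (by simp [hU3]) (by simp [hU3])⟩
  case hk1 =>
    intro b u' hu
    simp only at hu
    -- first answer
    set a₁ := (boolUnpair s).1 with ha₁
    set s' := (boolUnpair s).2 with hs'
    set b₁ := decide (a₁ = encodeBool true) with hb₁
    have hparts := length_boolUnpair_parts_le s
    have hla₁ : a₁.length ≤ N := by rw [ha₁]; omega
    have hls' : s'.length ≤ N := by rw [hs']; omega
    set U4 := Function.update U3 (Sum.inr .FA1) (flag b₁) with hU4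
    have h3 : Runs (NOp.isT (vv .A) (vv .FA1)).com (qst (u', s') (Function.update U3 (Sum.inr .A) a₁))
        (qst (u', s') U4) (7 * (N + 1) ^ 3) :=
      runs_isT_A .FA1 (by decide) _ U3 a₁ hla₁ (by simp [hU3]) (by simp [hU3])
    set U5 := Function.update (Function.update (Function.update (encSt (mkC Q p g y) v₁) (Sum.inr .FC) (flag coin))
      (Sum.inr .Z) (encodeNat z₂)) (Sum.inr .FA1) (flag b₁) with hU5
    have h4 : Runs voteS2.com (qst (u', s') U4) (qst (u', s') U5) (2930 * (N + 1) ^ 3) := by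
      have hle : (encodeNat (rs + (p - 1) / 2)).length ≤ N := hB.lenR (by omega)
      have hz₂' : v.x * g ^ (rs + (p - 1) / 2) % p = z₂ := rfl
      refine NS.runs_of_eq (N := N) voteS2 _ ?_ ?_ ?_
      · simp [voteS2, vv, cc, hU4, hU3, hv₁, hlrs, hlh, hle, hp1, hp0, hlp, hlx, hlg, hlmod, hB.len_lt hz₁p]
      · simp [voteS2, vv, cc, hU4, hU3, hU5, hv₁, hz₂']
        congr 1; funext r; rcases r with r | r
        · simp
        · cases r <;> simp
      · simp [voteS2]
    have hA5 : U5 (Sum.inr BV.A) = [] := by simp [hU5]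
    refine (impl_runs_seq h3 (impl_runs_seq h4
      (impl_query (Sum.inr .A) (B₁ := 71 * (N + 1) ^ 3) (B₂ := 89 * (N + 1) ^ 3) ?hb2 ?hk2))).mono ?hm2
    case hm2 =>
      rw [hA5]
      generalize (N + 1) ^ 3 = U at hU hU1 ⊢
      simp only [List.length_nil]
      omega
    case hb2 =>
      intro hu'
      simp only at hu'; subst hu'
      exact ⟨U5, runs_buildS hB s' U5 (by simp [hU5]) (by simp [hU5]) (by simp [hU5, hz₂]) hz₂p (by simp [hU5])
        (by simp [hU5])⟩
    case hk2 =>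
      intro b' u'' hu'
      simp only at hu'
      set a₂ := (boolUnpair s').1 with ha₂
      set s'' := (boolUnpair s').2 with hs''
      set b₂ := decide (a₂ = encodeBool true) with hb₂
      have hparts' := length_boolUnpair_parts_le s'
      have hla₂ : a₂.length ≤ N := by rw [ha₂]; omega
      have h5 : Runs (NOp.isT (vv .A) (vv .FA2)).com (qst (u'', s'') (Function.update U5 (Sum.inr .A) a₂))
          (qst (u'', s'') (Function.update U5 (Sum.inr .FA2) (flag b₂))) (7 * (N + 1) ^ 3) :=
        runs_isT_A .FA2 (by decide) _ U5 a₂ hla₂ (by simp [hU5]) (by simp [hU5])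
      have h6 := runs_voteS3 hB (u'', s'') v₁ coin b₁ b₂ hz₂p (by simpa [hv₁] using hcnt)
      rw [← hU5] at h6
      refine (impl_runs_seq h5 (impl_of_runs h6 ?_)).mono (by omega)
      simp [hv₁]

end Vote
/-! ### The square root (Adleman–Manders–Miller through the generator) -/

section Sqrt

variable {Q : Polynomial ℕ} {p g y N : ℕ}

/-- The Pohlig–Hellman index after `i` bits is below `2^i`. [Kranakis 1986, Thm. 1.18] [folklore] -/
theorem bmPH2_lt (p zinv E s : ℕ) : ∀ i, bmPH2 p zinv E s i < 2 ^ i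
  | 0 => by simp [bmPH2]
  | i + 1 => by
    rw [bmPH2, pow_succ]
    have := bmPH2_lt p zinv E s i
    split <;> omega

/-- Halving a numeral is dropping its lowest bit. [folklore] -/
theorem encodeNat_div_two (n : ℕ) : encodeNat (n / 2) = (encodeNat n).tail := by
  have h1 : bitsToNat ((encodeNat n).tail) = n / 2 := by
    have h := bitsToNat_encodeNat n
    cases hw : encodeNat n with
    | nil => rw [hw] at h; simp at h; subst h; simp
    | cons b w =>
      rw [hw] at h
      simp only [bitsToNat_cons] at h
      simp only [List.tail_cons]
      cases b <;> simp at h <;> omega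
  have h2 : norm ((encodeNat n).tail) = (encodeNat n).tail := by
    have hn : norm (encodeNat n) = encodeNat n := by rw [norm_eq_encodeNat, bitsToNat_encodeNat]
    cases hw : encodeNat n with
    | nil => simp
    | cons b w =>
      rw [hw] at hn
      rw [norm_cons] at hn
      simp only [List.tail_cons]
      by_cases hw0 : norm w = []
      · rw [if_pos hw0] at hn
        cases b <;> simp at hn
        subst hn
        simp
      · rw [if_neg hw0] at hn
        exact (List.cons.inj hn).2
  rw [← h2, norm_eq_encodeNat, h1]

/-- Dropping the lowest bit of a numeral halves it. [folklore] -/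
@[simp] theorem tail_encodeNat (n : ℕ) : (encodeNat n).tail = encodeNat (n / 2) := (encodeNat_div_two n).symm

/-- The exponent register of the Pohlig–Hellman loop at round `j < s` holds `2^{s-1-j}`. [folklore] -/
theorem two_pow_div_two_pow_succ {s j : ℕ} (hj : j < s) : 2 ^ s / 2 ^ (j + 1) = 2 ^ (s - 1 - j) := by
  rw [Nat.pow_div (by omega) two_pos]; congr 1; omega

/-- Halving it once more. [folklore] -/
theorem two_pow_div_two_pow_div_two (s j : ℕ) : 2 ^ s / 2 ^ (j + 1) / 2 = 2 ^ s / 2 ^ (j + 2) := by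
  rw [Nat.div_div_eq_div_mul, ← pow_succ]

open NS NOp in
/-- Before the Pohlig–Hellman loop: `EE := e^t`, `D := 0` (it is), `P2I := 1`, `PW := 2^{s-1}`, and
load the counter `CS` with `s` marks. [Kranakis 1986, Thm. 1.15 and 1.18] [folklore] -/
def sqrtPreS : NS O :=
  ofList [.powMod (vv .EE) (vv .E) (cc .OD) (cc .P), .const (vv .P2I) (encodeNat 1), .copy (cc .PW2) (vv .PW),
    .drop (vv .PW), .copy (cc .CSU) (vv .CS)]

open NS NOp in
/-- The body of the Pohlig–Hellman loop: test `(E z^{-D})^{2^{s-1-i}} ≡ 1`, add the bit `2^i` to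
`D` if not, double `P2I`, halve `PW`. [Kranakis 1986, Thm. 1.18, algorithm `A₂`] [folklore] -/
def ph2BodyS : NS O :=
  ofList [.powMod (vv .T1) (cc .ZI) (vv .D) (cc .P), .mulMod (vv .T1) (vv .EE) (cc .P),
    .powMod (vv .T2) (vv .T1) (vv .PW) (cc .P), .eq (vv .FQ) (vv .T2) (cc .ONE) (vv .FT)] |>.seq
  (.seq (ite (vv .FQ) nop (op (.add (vv .D) (vv .D) (vv .P2I))))
    (ofList [.clear (vv .T1), .clear (vv .T2), .add (vv .P2I) (vv .P2I) (vv .P2I), .drop (vv .PW)]))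

open NS NOp in
/-- After the loop: `X := e^{(t+1)/2} · (z^{-1})^{⌊D/2⌋} mod p`, and clean up.
[Blum–Micali 1984, §3.3, proof of Lemma 1, Step 3; Kranakis 1986, Thm. 1.15] [folklore] -/
def sqrtPostS : NS O :=
  ofList [.powMod (vv .X) (vv .E) (cc .EXH) (cc .P), .divMod (vv .T1) (vv .T2) (vv .D) (cc .TWO), .clear (vv .T2),
    .powMod (vv .T2) (cc .ZI) (vv .T1) (cc .P), .mulMod (vv .X) (vv .T2) (cc .P), .clear (vv .T1), .clear (vv .T2),
    .clear (vv .EE), .clear (vv .D), .clear (vv .P2I), .clear (vv .PW)]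

/-- The square-root program. [Blum–Micali 1984, §3.3, proof of Lemma 1, Step 3] [folklore] -/
def sqrtProg : Com (EReg ⊕ O) :=
  sqrtPreS.com ;; (loop (Sum.inr (vv .CS)) ph2BodyS.com ph2BodyS.com ;; sqrtPostS.com)

/-- The loop state of the Pohlig–Hellman loop after `j` rounds. [folklore] -/
def ph2Vars (p g : ℕ) (v : Vars) (e : ℕ) (j : ℕ) : Vars :=
  { v with ee := e ^ bmOddPart p % p,
           d := bmPH2 p (g ^ (p - 1 - bmOddPart p) % p) (e ^ bmOddPart p % p) (bmTwoExp p) j,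
           p2i := 2 ^ j, pw := 2 ^ bmTwoExp p / 2 ^ (j + 1) }

/-- **One round of the Pohlig–Hellman loop**: from the loop state after `j < s` rounds to the
state after `j + 1` rounds (the counter `CS` untouched), in `4997 (N+1)³` steps.
[Kranakis 1986, Thm. 1.18, algorithm `A₂`] [cite: Kranakis1986, Thm. 1.18] -/
theorem runs_ph2Body (hB : Bnd Q p g y N) (σ : List Bool × List Bool) (v : Vars) {j : ℕ}
    (hj : j < bmTwoExp p) (w : List Bool) :
    Runs ph2BodyS.com (qst σ (Function.update (encSt (mkC Q p g y) (ph2Vars p g v v.e j)) (Sum.inr .CS) w))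
      (qst σ (Function.update (encSt (mkC Q p g y) (ph2Vars p g v v.e (j + 1))) (Sum.inr .CS) w)) (4997 * (N + 1) ^ 3) := by
  have hp0 := hB.p_pos
  have hp1 := hB.one_lt
  have h2s : 2 ^ bmTwoExp p ≤ p := hB.two_pow_s_le.trans (Nat.sub_le p 1)
  have h2j : 2 ^ j ≤ p := (Nat.pow_le_pow_right two_pos hj.le).trans h2s
  have hD : bmPH2 p (g ^ (p - 1 - bmOddPart p) % p) (v.e ^ bmOddPart p % p) (bmTwoExp p) j ≤ p :=
    ((bmPH2_lt _ _ _ _ j).le.trans (Nat.pow_le_pow_right two_pos hj.le)).trans h2s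
  have hpw : 2 ^ bmTwoExp p / 2 ^ (j + 1) ≤ p := (Nat.div_le_self _ _).trans h2s
  -- the test, machine form (as `simp` writes it) and mathematical form
  have hconv : (((g ^ (p - 1 - bmOddPart p) % p) ^ (bmPH2 p (g ^ (p - 1 - bmOddPart p) % p) (v.e ^ bmOddPart p % p) (bmTwoExp p) j) * v.e ^ bmOddPart p % p) ^ (2 ^ bmTwoExp p / 2 ^ (j + 1)) % p = 1) ↔
      (((v.e ^ bmOddPart p % p) * (g ^ (p - 1 - bmOddPart p) % p) ^ (bmPH2 p (g ^ (p - 1 - bmOddPart p) % p) (v.e ^ bmOddPart p % p) (bmTwoExp p) j)) ^ 2 ^ (bmTwoExp p - 1 - j) % p = 1) := by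
    rw [← Nat.pow_mod, two_pow_div_two_pow_succ hj]
    conv_rhs => rw [Nat.pow_mod, Nat.mod_mul_mod, ← Nat.pow_mod, mul_comm]
  have h22 : 2 ^ j + 2 ^ j = 2 ^ (j + 1) := by rw [pow_succ]; ring
  have hlmod : ∀ x, (encodeNat (x % p)).length ≤ N := hB.len_mod
  have h1N := hB.one_le_N
  have hlp := hB.len_p
  have hlD := hB.len_le hD
  have hlpw := hB.len_le hpw
  have hl2j := hB.len_le h2j
  have hl2j1 : (encodeNat (2 ^ j)).length ≤ N + 1 := hl2j.trans N.le_succ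
  have hlD1 : (encodeNat (bmPH2 p (g ^ (p - 1 - bmOddPart p) % p) (v.e ^ bmOddPart p % p) (bmTwoExp p) j)).length ≤ N + 1 :=
    hlD.trans N.le_succ
  by_cases hm : ((g ^ (p - 1 - bmOddPart p) % p) ^ (bmPH2 p (g ^ (p - 1 - bmOddPart p) % p) (v.e ^ bmOddPart p % p) (bmTwoExp p) j) * v.e ^ bmOddPart p % p) ^ (2 ^ bmTwoExp p / 2 ^ (j + 1)) % p = 1
  · have hm' := hconv.1 hm
    refine NS.runs_of_eq (N := N) ph2BodyS _ ?_ ?_ ?_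
    · simp [ph2BodyS, vv, cc, ph2Vars, hm, hlmod, h1N, hlp, hp1, hp0, hlD, hlpw, hl2j, hl2j1, hlD1]
    · simp [ph2BodyS, vv, cc, ph2Vars, hm]
      congr 1; funext r; rcases r with r | r
      · simp [bmPH2, hm', h22, two_pow_div_two_pow_div_two]
      · cases r <;> simp [bmPH2, hm', h22, two_pow_div_two_pow_div_two]
    · simp [ph2BodyS]
  · have hm' : ¬(((v.e ^ bmOddPart p % p) * (g ^ (p - 1 - bmOddPart p) % p) ^ (bmPH2 p (g ^ (p - 1 - bmOddPart p) % p) (v.e ^ bmOddPart p % p) (bmTwoExp p) j)) ^ 2 ^ (bmTwoExp p - 1 - j) % p = 1) := fun h => hm (hconv.2 h)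
    refine NS.runs_of_eq (N := N) ph2BodyS _ ?_ ?_ ?_
    · simp [ph2BodyS, vv, cc, ph2Vars, hm, hlmod, h1N, hlp, hp1, hp0, hlD, hlpw, hl2j, hl2j1, hlD1]
    · simp [ph2BodyS, vv, cc, ph2Vars, hm]
      congr 1; funext r; rcases r with r | r
      · simp [bmPH2, hm', h22, two_pow_div_two_pow_div_two]
      · cases r <;> simp [bmPH2, hm', h22, two_pow_div_two_pow_div_two]
    · simp [ph2BodyS]

/-- **The square-root program computes `bmSqrt`** of the residue in `E` into `X` (its scratch
back to empty), in `12100 (N+1)⁴` steps. [Blum–Micali 1984, §3.3, proof of Lemma 1, Step 3;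
Kranakis 1986, Thm. 1.15 with Thm. 1.18] [cite: Kranakis1986, Thm. 1.15] -/
theorem runs_sqrtProg (hB : Bnd Q p g y N) (σ : List Bool × List Bool) (v : Vars) (hx : v.x < p) (he : v.e < p)
    (hee : v.ee = 0) (hd : v.d = 0) (hp2i : v.p2i = 0) (hpw : v.pw = 0) :
    Runs sqrtProg (st σ (mkC Q p g y) v) (st σ (mkC Q p g y) { v with x := bmSqrt p g v.e }) (12100 * (N + 1) ^ 4) := by
  have hp0 := hB.p_pos
  have hp1 := hB.one_lt
  have h2s : 2 ^ bmTwoExp p ≤ p := hB.two_pow_s_le.trans (Nat.sub_le p 1)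
  have hsN : bmTwoExp p ≤ N := hB.s_le
  have hlmod : ∀ x, (encodeNat (x % p)).length ≤ N := hB.len_mod
  have h1N := hB.one_le_N
  have h2N := hB.two_le_N
  have hlp := hB.len_p
  have hU : N + 1 ≤ (N + 1) ^ 3 := succ_le_cube N
  -- the loop states
  let S : ℕ → Regs (EReg ⊕ O) := fun j => st σ (mkC Q p g y) (ph2Vars p g v v.e j)
  have e1 : ∀ i (w : List Bool), Function.update (S i) (Sum.inr (vv .CS)) w =
      qst σ (Function.update (encSt (mkC Q p g y) (ph2Vars p g v v.e i)) (Sum.inr .CS) w) := fun i w => by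
    simp [S, vv]
  -- before the loop
  have h1 : Runs sqrtPreS.com (st σ (mkC Q p g y) v)
      (qst σ (Function.update (encSt (mkC Q p g y) (ph2Vars p g v v.e 0)) (Sum.inr .CS) (List.replicate (bmTwoExp p) true)))
      (1932 * (N + 1) ^ 3) := by
    have hod : (encodeNat (bmOddPart p)).length ≤ N := hB.len_le ((bmOddPart_le p).trans (Nat.sub_le p 1))
    refine NS.runs_of_eq (N := N) sqrtPreS _ ?_ ?_ ?_
    · simp [sqrtPreS, vv, cc, hee, hp2i, hpw, hB.len_lt he, hod, hlp, hp1, h1N, hB.len_le h2s, hsN]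
    · simp [sqrtPreS, vv, cc, ph2Vars]
      congr 1; funext r; rcases r with r | r
      · simp
      · cases r <;> simp [bmPH2, hd, hpw]
    · simp [sqrtPreS]
  -- the loop
  have h2 : Runs (loop (Sum.inr (vv .CS)) ph2BodyS.com ph2BodyS.com)
      (qst σ (Function.update (encSt (mkC Q p g y) (ph2Vars p g v v.e 0)) (Sum.inr .CS) (List.replicate (bmTwoExp p) true)))
      (S (bmTwoExp p)) (N * (4997 * (N + 1) ^ 3 + 2) + 1) := by
    have hC : ∀ j, S j (Sum.inr (vv .CS)) = [] := fun j => by simp [S, vv]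
    have hbody : ∀ j (w : List Bool), j < bmTwoExp p →
        Runs ph2BodyS.com (Function.update (S j) (Sum.inr (vv .CS)) w)
          (Function.update (S (j + 1)) (Sum.inr (vv .CS)) w) (4997 * (N + 1) ^ 3) := by
      intro j w hj
      rw [e1, e1]
      exact runs_ph2Body hB σ v hj w
    have := runs_loop_count S (4997 * (N + 1) ^ 3) (bmTwoExp p) hC hbody (List.replicate (bmTwoExp p) true) 0
      (by simp)
    simp only [List.length_replicate, Nat.zero_add] at this
    rw [e1] at this
    refine this.mono ?_
    exact Nat.succ_le_succ (Nat.mul_le_mul_right _ hsN)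
  -- after the loop
  have h3 : Runs sqrtPostS.com (S (bmTwoExp p)) (st σ (mkC Q p g y) { v with x := bmSqrt p g v.e })
      (5111 * (N + 1) ^ 3) := by
    have hD : bmPH2 p (g ^ (p - 1 - bmOddPart p) % p) (v.e ^ bmOddPart p % p) (bmTwoExp p) (bmTwoExp p) ≤ p :=
      (bmPH2_lt _ _ _ _ _).le.trans h2s
    have hexh : (bmOddPart p + 1) / 2 ≤ p := by
      have := bmOddPart_le p; omega
    have hsq : v.e ^ ((bmOddPart p + 1) / 2) % p *
        ((g ^ (p - 1 - bmOddPart p) % p) ^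
          (bmPH2 p (g ^ (p - 1 - bmOddPart p) % p) (v.e ^ bmOddPart p % p) (bmTwoExp p) (bmTwoExp p) / 2) % p) % p =
        bmSqrt p g v.e := by
      rw [bmSqrt, Nat.mul_mod, Nat.mod_mod, Nat.mod_mod, ← Nat.mul_mod]
    have hl2 : (encodeNat 2).length ≤ N := hB.len_le hB.two_le
    have hlD2 : (encodeNat (bmPH2 p (g ^ (p - 1 - bmOddPart p) % p) (v.e ^ bmOddPart p % p) (bmTwoExp p) (bmTwoExp p) %
        2)).length ≤ N := hB.len_lt (lt_trans (Nat.mod_lt _ two_pos) hB.two_lt)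
    have hpw0 : 2 ^ bmTwoExp p / 2 ^ (bmTwoExp p + 1) = 0 :=
      Nat.div_eq_of_lt (Nat.pow_lt_pow_right (by norm_num) (Nat.lt_succ_self _))
    refine NS.runs_of_eq (N := N) sqrtPostS _ ?_ ?_ ?_
    · simp [sqrtPostS, vv, cc, ph2Vars, hB.len_lt hx, hB.len_lt he, hB.len_le hexh, hlp, hp1, hp0, hB.len_le hD,
        hlmod, hB.len_le h2s, hB.len_le (le_trans (Nat.div_le_self _ 2) hD), hl2, hlD2, hpw0]
    · simp [sqrtPostS, vv, cc, ph2Vars, hsq]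
      congr 1; funext r; rcases r with r | r
      · simp
      · cases r <;> simp [hee, hd, hp2i, hpw]
    · simp [sqrtPostS]
  refine (h1.seq (h2.seq h3)).mono ?_
  have hN3 : N * (4997 * (N + 1) ^ 3 + 2) + 1 ≤ 5000 * (N + 1) ^ 4 := by
    have : N * (4997 * (N + 1) ^ 3 + 2) ≤ N * (4999 * (N + 1) ^ 3) := Nat.mul_le_mul_left _ (by nlinarith [one_le_cube N])
    calc N * (4997 * (N + 1) ^ 3 + 2) + 1 ≤ N * (4999 * (N + 1) ^ 3) + (N + 1) ^ 3 := by
          have := one_le_cube N; omega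
      _ ≤ 5000 * (N + 1) ^ 4 := by rw [pow_succ]; nlinarith [one_le_cube N]
  have hU4 : (N + 1) ^ 3 ≤ (N + 1) ^ 4 := Nat.pow_le_pow_right (Nat.succ_pos N) (by norm_num)
  nlinarith

end Sqrt

/-! ### The votes and the selection -/

section Select

variable {Q : Polynomial ℕ} {p g y N : ℕ}

/-- **The votes loop implements `forEach` of the `m` votes**, reading consecutive coin blocks,
and counts the `true` votes in `CNT`. [Blum–Micali 1984, §3.3, Lemma 2] [folklore] -/
theorem impl_votes (hB : Bnd Q p g y N) {σ : List Bool × List Bool} (hσ : σ.2.length ≤ N) (v : Vars)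
    (r₀ : List Bool) (b₀ : ℕ) (blk : Fin (bmM Q p) → Fin (bmK Q p + 1) → Bool)
    (hblk : ∀ j, blk j = blkAt r₀ (b₀ + j * (bmK Q p + 1)) (bmK Q p))
    (hr : v.r = r₀.drop b₀) (hx : v.x < p) (hcnt : v.cnt = 0) (hcj : v.cj = []) :
    Impl (loop (ru (Sum.inr .CJ)) voteProg voteProg)
      (OracleComp.forEach (fun j => bmVoteC p g v.x (bmShift p (bmK Q p) (blk j)) (bmCoin (bmK Q p) (blk j)))
        (List.finRange (bmM Q p)))
      σ (encSt (mkC Q p g y) { v with cj := List.replicate (bmM Q p) true })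
      (fun votes T' => votes.length = bmM Q p ∧ T' = encSt (mkC Q p g y)
        { v with r := r₀.drop (b₀ + bmM Q p * (bmK Q p + 1)), cnt := votes.count true })
      (6603 * (N + 1) ^ 4) := by
  -- the invariant after the votes `done`
  let inv : List Bool → Regs (BC ⊕ BV) → Prop := fun done T =>
    T = encSt (mkC Q p g y) { v with r := r₀.drop (b₀ + done.length * (bmK Q p + 1)), cnt := done.count true }
  have hC : ∀ done T, inv done T → T (Sum.inr .CJ) = [] := fun done T hT => by simp [inv, hT, hcj]
  have hbody : ∀ (done : List Bool) (σ : List Bool × List Bool) (T : Regs (BC ⊕ BV)) (w : List Bool)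
      (hd : done.length < (List.finRange (bmM Q p)).length), σ.2.length ≤ N → inv done T →
      Impl voteProg ((fun j => bmVoteC p g v.x (bmShift p (bmK Q p) (blk j)) (bmCoin (bmK Q p) (blk j)))
        ((List.finRange (bmM Q p))[done.length]))
        σ (Function.update T (Sum.inr .CJ) w)
        (fun b T' => T' (Sum.inr .CJ) = w ∧ inv (done ++ [b]) (Function.update T' (Sum.inr .CJ) [])) (6600 * (N + 1) ^ 3) := by
    intro done σ T w hd hσ hT
    simp only [inv] at hT
    subst hT
    simp only [List.getElem_finRange, hblk, update_encSt_CJ]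
    have hlen : done.length < bmM Q p := by simpa using hd
    have := impl_vote hB hσ { v with r := r₀.drop (b₀ + done.length * (bmK Q p + 1)), cnt := done.count true, cj := w }
      r₀ (b₀ + done.length * (bmK Q p + 1)) rfl hx
      (lt_of_le_of_lt (List.count_le_length) hlen)
    refine this.weaken fun b T' hT' => ?_
    subst hT'
    refine ⟨by simp, ?_⟩
    simp only [inv, update_encSt_CJ, List.length_append, List.length_singleton, List.count_append, hcj]
    congr 2
    · rw [Nat.succ_mul, Nat.add_assoc]
    · cases b <;> simp
  have h := impl_forEach (Sum.inr .CJ) voteProg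
    (fun j => bmVoteC p g v.x (bmShift p (bmK Q p) (blk j)) (bmCoin (bmK Q p) (blk j))) (List.finRange (bmM Q p))
    inv (6600 * (N + 1) ^ 3) N hC hbody (List.replicate (bmM Q p) true) [] σ (encSt (mkC Q p g y) v)
    (by simp) hσ (by simp only [inv]; congr 1; cases v; simp_all)
  simp only [List.length_nil, List.drop_zero, List.nil_append, update_encSt_CJ, List.length_replicate] at h
  refine (h.weaken fun bs T' hT' => ⟨hT'.1, by rw [hT'.2, hT'.1]⟩).mono ?_
  have hm := hB.m_le
  have : bmM Q p * (6600 * (N + 1) ^ 3 + 2) ≤ N * (6602 * (N + 1) ^ 3) :=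
    Nat.mul_le_mul hm (by nlinarith [one_le_cube N])
  calc bmM Q p * (6600 * (N + 1) ^ 3 + 2) + 1 ≤ N * (6602 * (N + 1) ^ 3) + (N + 1) ^ 3 := by
        have := one_le_cube N; omega
    _ ≤ 6603 * (N + 1) ^ 4 := by rw [pow_succ]; nlinarith [one_le_cube N]

open NS NOp in
/-- After the votes: compare `2 · CNT` with `m`; without a strict majority replace the candidate by
the other square root `X · g^h`; clear the counters. [Blum–Micali 1984, §3.3, Lemma 2] [folklore] -/
def selFinS : NS O :=
  (ofList [.add (vv .C2) (vv .CNT) (vv .CNT), .cmp (vv .FM) (cc .M) (vv .C2)]).seq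
    ((ite (vv .FM) (op (.mulMod (vv .X) (cc .GH) (cc .P))) nop).seq (ofList [.clear (vv .C2), .clear (vv .CNT)]))

/-- **The selector program**: square root, load the vote counter, the votes loop, the final
comparison. [Blum–Micali 1984, §3.3, Lemma 2 (as used in the proof of Theorem 3)] [folklore] -/
def selProg : Com (EReg ⊕ O) :=
  sqrtProg ;; ((NOp.copy (cc .MU) (vv .CJ)).com ;; (loop (ru (Sum.inr .CJ)) voteProg voteProg ;; selFinS.com))

/-- The selector computation, as "votes, then a pure selection". [folklore] -/
theorem bmSelectC_eq (p g m k : ℕ) (blk : Fin m → Fin (k + 1) → Bool) (e : ℕ) :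
    bmSelectC p g m k blk e = OracleComp.bind
      (OracleComp.forEach (fun j => bmVoteC p g (bmSqrt p g e) (bmShift p k (blk j)) (bmCoin k (blk j))) (List.finRange m))
      (fun votes => OracleComp.pure
        (if m < 2 * votes.count true then bmSqrt p g e else bmSqrt p g e * g ^ ((p - 1) / 2) % p)) := rfl

/-- **The selector program implements `bmSelectC`** on the residue in `E`, with the coin blocks
at the current coin position: afterwards `X` holds the selected square root and `m (k+1)` coins
are consumed. [Blum–Micali 1984, §3.3, Lemma 2] [folklore] -/
theorem impl_select (hB : Bnd Q p g y N) {σ : List Bool × List Bool} (hσ : σ.2.length ≤ N) (v : Vars)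
    (r₀ : List Bool) (b₀ : ℕ) (blk : Fin (bmM Q p) → Fin (bmK Q p + 1) → Bool)
    (hblk : ∀ j, blk j = blkAt r₀ (b₀ + j * (bmK Q p + 1)) (bmK Q p))
    (hr : v.r = r₀.drop b₀) (hx : v.x < p) (he : v.e < p) (hcnt : v.cnt = 0) (hcj : v.cj = [])
    (hee : v.ee = 0) (hd : v.d = 0) (hp2i : v.p2i = 0) (hpw : v.pw = 0) :
    Impl selProg (bmSelectC p g (bmM Q p) (bmK Q p) blk v.e) σ (encSt (mkC Q p g y) v)
      (fun x T' => T' = encSt (mkC Q p g y) { v with r := r₀.drop (b₀ + bmM Q p * (bmK Q p + 1)), x := x })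
      (19800 * (N + 1) ^ 4) := by
  have hp0 := hB.p_pos
  have hU1 := one_le_cube N
  have hU4 : (N + 1) ^ 3 ≤ (N + 1) ^ 4 := Nat.pow_le_pow_right (Nat.succ_pos N) (by norm_num)
  set v₁ : Vars := { v with x := bmSqrt p g v.e } with hv₁
  have hsq : bmSqrt p g v.e < p := bmSqrt_lt hp0 g v.e
  -- square root
  have h1 := runs_sqrtProg hB σ v hx he hee hd hp2i hpw
  -- load the vote counter
  have h2 : Runs (NOp.copy (cc .MU) (vv .CJ)).com (st σ (mkC Q p g y) v₁)
      (qst σ (encSt (mkC Q p g y) { v₁ with cj := List.replicate (bmM Q p) true })) (13 * (N + 1) ^ 3) := by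
    refine NS.runs_of_eq (N := N) (NS.op (NOp.copy (cc .MU) (vv .CJ))) _ ?_ ?_ ?_
    · simp [vv, cc, hB.m_le]
    · simp [vv, cc, hv₁, hcj]
    · simp
  -- the votes
  have h3 := impl_votes hB hσ v₁ r₀ b₀ blk hblk (by simp [hv₁, hr]) (by simp [hv₁, hsq]) (by simp [hv₁, hcnt])
    (by simp [hv₁, hcj])
  -- the selection
  have h4 : ∀ (votes : List Bool) (σ' : List Bool × List Bool) (T' : Regs (BC ⊕ BV)),
      T' = encSt (mkC Q p g y) { v₁ with r := r₀.drop (b₀ + bmM Q p * (bmK Q p + 1)), cnt := votes.count true } →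
      votes.length = bmM Q p →
      ∃ T'', Runs selFinS.com (qst σ' T') (qst σ' T'') (1069 * (N + 1) ^ 3) ∧
        T'' = encSt (mkC Q p g y)
          { v with
            r := r₀.drop (b₀ + bmM Q p * (bmK Q p + 1))
            x := if bmM Q p < 2 * votes.count true then bmSqrt p g v.e
                 else bmSqrt p g v.e * g ^ ((p - 1) / 2) % p } := by
    intro votes σ' T' hT' hlen
    subst hT'
    have hc : votes.count true ≤ bmM Q p := hlen ▸ List.count_le_length
    have hlc : (encodeNat (votes.count true)).length ≤ N := len_of_le (hc.trans hB.m_le)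
    have hlc2 : (encodeNat (votes.count true + votes.count true)).length ≤ N := len_of_le (by have := hB.two_m_le; omega)
    have hlm : (encodeNat (bmM Q p)).length ≤ N := len_of_le hB.m_le
    refine ⟨_, ?_, rfl⟩
    by_cases hmaj : bmM Q p < 2 * votes.count true
    · have hdec : decide (votes.count true + votes.count true ≤ bmM Q p) = false := by simp; omega
      refine NS.runs_of_eq (N := N) selFinS _ ?_ ?_ ?_
      · simp [selFinS, vv, cc, hv₁, hlc, hlc2, hlm, hdec]
      · simp [selFinS, vv, cc, hv₁, hdec, hmaj]
        congr 1; funext r; rcases r with r | r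
        · simp [hcnt]
        · cases r <;> simp [hcnt]
      · simp [selFinS]
    · have hdec : decide (votes.count true + votes.count true ≤ bmM Q p) = true := by simp; omega
      refine NS.runs_of_eq (N := N) selFinS _ ?_ ?_ ?_
      · simp [selFinS, vv, cc, hv₁, hlc, hlc2, hlm, hdec, hB.len_lt hsq, hB.len_mod, hB.len_p, hp0]
      · simp [selFinS, vv, cc, hv₁, hdec, hmaj]
        congr 1; funext r; rcases r with r | r
        · simp [hcnt]
        · cases r <;> simp [hcnt]
      · simp [selFinS]
  rw [bmSelectC_eq]
  exact (impl_runs_seq h1 (impl_runs_seq h2 (impl_bind_pure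
    (impl_seq_runs h3 fun votes σ' T' hT' => h4 votes σ' T' hT'.2 hT'.1) fun votes T' hT' => hT'))).mono (by nlinarith)

end Select
/-! ### The round of the descent -/

section Round

variable {Q : Polynomial ℕ} {p g y N : ℕ}

/-- Strengthening the postcondition of an implementation by a property of *every* possible output
of the computation (whatever the answers). A deliberate dot-notation extension of
`Literature.Computability.Complexity.Com.Impl` (`StackOracle.lean`). [folklore] -/
theorem _root_.Literature.Computability.Complexity.Com.Impl.strengthen {β γ : Type} [DecidableEq β]
    {P : Com (EReg ⊕ Complexity.QReg ⊕ β)} {c : OracleComp γ} {σ : List Bool × List Bool}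
    {T : Regs β} {post : γ → Regs β → Prop} {B : ℕ} (h : Impl P c σ T post B) (q : γ → Prop)
    (hq : ∀ b σ', OracleComp.feedRaw c σ = Sum.inr (b, σ') → q b) : Impl P c σ T (fun b T' => q b ∧ post b T') B := by
  unfold Impl at h ⊢
  rcases hc : OracleComp.feedRaw c σ with q' | ⟨b, σ'⟩
  · rw [hc] at h; exact h
  · rw [hc] at h
    obtain ⟨T', hR, hp⟩ := h
    exact ⟨T', hR, hq b σ' hc, hp⟩

/-- Every output of the selector is a residue `< p`. [folklore] -/
theorem feedRaw_bmSelectC_lt (hp : 0 < p) (g m k : ℕ) (blk : Fin m → Fin (k + 1) → Bool) (e : ℕ)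
    (σ : List Bool × List Bool) {x : ℕ} {σ' : List Bool × List Bool}
    (h : OracleComp.feedRaw (bmSelectC p g m k blk e) σ = Sum.inr (x, σ')) : x < p := by
  rw [bmSelectC_eq, OracleComp.feedRaw_bind] at h
  split at h
  · simp at h
  · simp only [OracleComp.feedRaw_pure, Sum.inr.injEq, Prod.mk.injEq] at h
    rw [← h.1]
    split
    · exact bmSqrt_lt hp g e
    · exact Nat.mod_lt _ hp

open NS NOp in
/-- Before the selector: Euler's test `b := [e^h ≢ 1]`, then `E := e·g⁻¹ mod p` and
`ACC := ACC + TP` if `b`, and the flag `F1 := [E = 1]`. [Blum–Micali 1984, §3.3, proof of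
Lemma 1, Steps 1–2] [folklore] -/
def roundPreS : NS O :=
  (ofList [.powMod (vv .EU) (vv .E) (cc .H) (cc .P), .eq (vv .FB) (vv .EU) (cc .ONE) (vv .FT), .not (vv .FB),
    .clear (vv .EU)]).seq
  ((ite (vv .FB) (ofList [.mulMod (vv .E) (cc .GI) (cc .P), .add (vv .ACC) (vv .ACC) (vv .TP)]) nop).seq
    (op (.eq (vv .F1) (vv .E) (cc .ONE) (vv .FT))))

open NS NOp in
/-- After the selector: `E := 1` if the flag `F1` was set, else `E := X`; empty `X`; double `TP`.
[Blum–Micali 1984, §3.3, proof of Lemma 1] [folklore] -/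
def roundPostS : NS O :=
  (ite (vv .F1) (op (.clear (vv .X))) (ofList [.clear (vv .E), .move (vv .X) (vv .E)])).seq
    (op (.add (vv .TP) (vv .TP) (vv .TP)))

/-- **The round program.** [Blum–Micali 1984, §3.3, proof of Lemma 1, Steps 1–3] [folklore] -/
def roundProg : Com (EReg ⊕ O) := roundPreS.com ;; (selProg ;; roundPostS.com)

/-- The round as "selector on the adjusted residue, then a pure step". [folklore] -/
theorem bmRoundC_eq (p g m k : ℕ) (blk : Fin m → Fin (k + 1) → Bool) (e : ℕ) :
    bmRoundC p g m k blk e = OracleComp.bind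
      (bmSelectC p g m k blk ((if !decide (e ^ ((p - 1) / 2) % p = 1) then e * g ^ (p - 2) else e) % p))
      (fun s => OracleComp.pure (!decide (e ^ ((p - 1) / 2) % p = 1),
        if (if !decide (e ^ ((p - 1) / 2) % p = 1) then e * g ^ (p - 2) else e) % p = 1 then 1 else s)) := rfl

/-- **The round program implements `bmRoundC`**: afterwards `E` holds the new element, `ACC` has
received `TP` if the Euler bit was set, `TP` is doubled, and `m (k+1)` coins are consumed.
[Blum–Micali 1984, §3.3, proof of Lemma 1] [cite: BlumMicali1984, §3.3 Lemma 1 (proof)] -/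
theorem impl_round (hB : Bnd Q p g y N) {σ : List Bool × List Bool} (hσ : σ.2.length ≤ N) (v : Vars)
    (r₀ : List Bool) (b₀ : ℕ) (blk : Fin (bmM Q p) → Fin (bmK Q p + 1) → Bool)
    (hblk : ∀ j, blk j = blkAt r₀ (b₀ + j * (bmK Q p + 1)) (bmK Q p))
    (hr : v.r = r₀.drop b₀) (he : v.e < p) (hx : v.x = 0) (hcnt : v.cnt = 0) (hcj : v.cj = [])
    (hee : v.ee = 0) (hd : v.d = 0) (hp2i : v.p2i = 0) (hpw : v.pw = 0) (hf1 : v.f1 = false)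
    (hacc : v.acc ≤ 2 * p) (htp : v.tp ≤ 2 * p) :
    Impl roundProg (bmRoundC p g (bmM Q p) (bmK Q p) blk v.e) σ (encSt (mkC Q p g y) v)
      (fun be T' => T' = encSt (mkC Q p g y)
        { v with r := r₀.drop (b₀ + bmM Q p * (bmK Q p + 1)), e := be.2,
                 acc := v.acc + (if be.1 then v.tp else 0), tp := v.tp + v.tp })
      (23100 * (N + 1) ^ 4) := by
  have hp0 := hB.p_pos
  have hp1 := hB.one_lt
  have h1N := hB.one_le_N
  have hlp := hB.len_p
  have hU1 := one_le_cube N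
  have hU4 : (N + 1) ^ 3 ≤ (N + 1) ^ 4 := Nat.pow_le_pow_right (Nat.succ_pos N) (by norm_num)
  -- the Euler bit and the adjusted residue
  set b := !decide (v.e ^ ((p - 1) / 2) % p = 1) with hb
  set e' := (if b then v.e * g ^ (p - 2) else v.e) % p with he'
  have he'p : e' < p := Nat.mod_lt _ hp0
  set v₁ : Vars := { v with e := e', acc := v.acc + (if b then v.tp else 0), f1 := decide (e' = 1) } with hv₁
  -- before the selector
  have hpre : Runs roundPreS.com (st σ (mkC Q p g y) v) (st σ (mkC Q p g y) v₁) (3148 * (N + 1) ^ 3) := by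
    have hlacc : (encodeNat v.acc).length ≤ N := hB.lenR (by omega)
    have hltp : (encodeNat v.tp).length ≤ N := hB.lenR (by omega)
    have hlacc1 : (encodeNat v.acc).length ≤ N + 1 := hlacc.trans N.le_succ
    have hlh : (encodeNat ((p - 1) / 2)).length ≤ N := hB.len_le hB.h_lt.le
    by_cases hE : v.e ^ ((p - 1) / 2) % p = 1
    · have hbF : b = false := by simp [hb, hE]
      refine NS.runs_of_eq (N := N) roundPreS _ ?_ ?_ ?_
      · simp [roundPreS, vv, cc, hE, hB.len_lt he, hlh, hlp, hp1, hp0, hB.len_mod, h1N, hf1]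
      · simp [roundPreS, vv, cc, hE, hv₁, hbF, he', Nat.mod_eq_of_lt he]
        congr 1; funext r; rcases r with r | r
        · simp
        · cases r <;> simp
      · simp [roundPreS]
    · have hbT : b = true := by simp [hb, hE]
      refine NS.runs_of_eq (N := N) roundPreS _ ?_ ?_ ?_
      · simp [roundPreS, vv, cc, hE, hB.len_lt he, hlh, hlp, hp1, hp0, hB.len_mod, h1N, hlacc, hltp, hlacc1, hf1]
      · simp [roundPreS, vv, cc, hE, hv₁, hbT, he']
        congr 1; funext r; rcases r with r | r
        · simp
        · cases r <;> simp
      · simp [roundPreS]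
  -- the selector (its output is a residue)
  have hsel := (impl_select hB hσ v₁ r₀ b₀ blk hblk (by simp [hv₁, hr]) (by simp [hv₁, hx, hp0]) (by simp [hv₁, he'p])
    (by simp [hv₁, hcnt]) (by simp [hv₁, hcj]) (by simp [hv₁, hee]) (by simp [hv₁, hd]) (by simp [hv₁, hp2i])
    (by simp [hv₁, hpw])).strengthen (fun x => x < p) (fun x σ' h => feedRaw_bmSelectC_lt hp0 _ _ _ _ _ _ h)
  rw [show v₁.e = e' from rfl] at hsel
  -- after the selector
  have hpost : ∀ (x : ℕ) (σ' : List Bool × List Bool) (T' : Regs (BC ⊕ BV)),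
      (x < p ∧ T' = encSt (mkC Q p g y) { v₁ with r := r₀.drop (b₀ + bmM Q p * (bmK Q p + 1)), x := x }) →
      ∃ T'', Runs roundPostS.com (qst σ' T') (qst σ' T'') (78 * (N + 1) ^ 3) ∧
        T'' = encSt (mkC Q p g y)
          { v with
            r := r₀.drop (b₀ + bmM Q p * (bmK Q p + 1))
            e := if e' = 1 then 1 else x
            acc := v.acc + (if b then v.tp else 0)
            tp := v.tp + v.tp } := by
    rintro x σ' T' ⟨hxp, hT'⟩
    subst hT'
    have hltp : (encodeNat v.tp).length ≤ N := hB.lenR (by omega)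
    have hltp1 : (encodeNat v.tp).length ≤ N + 1 := hltp.trans N.le_succ
    refine ⟨_, ?_, rfl⟩
    by_cases h1 : e' = 1
    · refine NS.runs_of_eq (N := N) roundPostS _ ?_ ?_ ?_
      · simp [roundPostS, vv, hv₁, h1, hB.len_lt hxp, hltp, hltp1]
      · simp [roundPostS, vv, hv₁, h1]
        congr 1; funext r; rcases r with r | r
        · simp
        · cases r <;> simp [hx, hf1]
      · simp [roundPostS]
    · refine NS.runs_of_eq (N := N) roundPostS _ ?_ ?_ ?_
      · simp [roundPostS, vv, hv₁, h1, hB.len_lt hxp, hltp, hltp1, hB.len_lt he'p]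
      · simp [roundPostS, vv, hv₁, h1]
        congr 1; funext r; rcases r with r | r
        · simp
        · cases r <;> simp [hx, hf1]
      · simp [roundPostS]
  rw [bmRoundC_eq, ← hb, ← he']
  refine (impl_runs_seq hpre (impl_bind_pure (impl_seq_runs hsel hpost) fun s T' hT' => hT')).mono ?_
  generalize (N + 1) ^ 3 = U at hU4 ⊢
  generalize (N + 1) ^ 4 = W at hU4 ⊢
  omega

end Round
/-! ### The descent -/

section Descent

variable {Q : Polynomial ℕ} {p g y N : ℕ}

/-- Every element output by a round is a residue `< p`. [folklore] -/
theorem feedRaw_bmRoundC_snd_lt (hp : 1 < p) (g m k : ℕ) (blk : Fin m → Fin (k + 1) → Bool) (e : ℕ)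
    (σ : List Bool × List Bool) {be : Bool × ℕ} {σ' : List Bool × List Bool}
    (h : OracleComp.feedRaw (bmRoundC p g m k blk e) σ = Sum.inr (be, σ')) : be.2 < p := by
  rw [bmRoundC_eq, OracleComp.feedRaw_bind] at h
  split at h
  · simp at h
  · rename_i x σ₁ hx
    simp only [OracleComp.feedRaw_pure, Sum.inr.injEq, Prod.mk.injEq] at h
    rw [← h.1]
    have hx' := feedRaw_bmSelectC_lt (by omega) g m k blk _ σ hx
    dsimp only
    split_ifs <;> first | exact hp | exact hx'

/-- The descent step as "a round, then a pure update of the loop state". [folklore] -/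
theorem bmDescentStepC_eq (p g ℓ m k : ℕ) (ω : Fin ℓ → Fin m → Fin (k + 1) → Bool) (s : ℕ × ℕ × ℕ) :
    bmDescentStepC p g ℓ m k ω s = OracleComp.bind (bmRoundC p g m k (bmBlk ℓ m k ω s.1) s.2.1)
      (fun be => OracleComp.pure (s.1 + 1, be.2, s.2.2 + if be.1 then 2 ^ s.1 else 0)) := rfl

/-- **The descent loop implements `iterM` of the descent step** (Blum–Micali's Lemma 1
algorithm, `ℓ` rounds): afterwards `E` holds the final element, `ACC` the index found (`< 2^ℓ`),
`TP = 2^ℓ`, and `ℓ m (k+1)` coins are consumed. [Blum–Micali 1984, §3.3, Lemma 1]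
[cite: BlumMicali1984, §3.3 Lemma 1] -/
theorem impl_descent (hB : Bnd Q p g y N) {σ : List Bool × List Bool} (hσ : σ.2.length ≤ N) (v : Vars)
    (r₀ : List Bool) (B : ℕ) (ω : Fin p.size → Fin (bmM Q p) → Fin (bmK Q p + 1) → Bool)
    (hω : ∀ t j, ω t j = blkAt r₀ (B + (t * bmM Q p + j) * (bmK Q p + 1)) (bmK Q p))
    (hr : v.r = r₀.drop B) (he : v.e < p) (hx : v.x = 0) (hcnt : v.cnt = 0) (hcj : v.cj = [])
    (hee : v.ee = 0) (hd : v.d = 0) (hp2i : v.p2i = 0) (hpw : v.pw = 0) (hf1 : v.f1 = false)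
    (hacc : v.acc = 0) (htp : v.tp = 1) (hct : v.ct = []) :
    Impl (loop (ru (Sum.inr .CT)) roundProg roundProg)
      (OracleComp.iterM (bmDescentStepC p g p.size (bmM Q p) (bmK Q p) ω) p.size (0, v.e, 0))
      σ (encSt (mkC Q p g y) { v with ct := List.replicate p.size true })
      (fun s T' => s.2.1 < p ∧ s.2.2 < 2 ^ p.size ∧ T' = encSt (mkC Q p g y)
        { v with r := r₀.drop (B + p.size * bmM Q p * (bmK Q p + 1)), e := s.2.1, acc := s.2.2, tp := 2 ^ p.size })
      (23103 * (N + 1) ^ 5) := by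
  have hp1 := hB.one_lt
  have h2l : 2 ^ p.size ≤ 2 * p := hB.two_pow_l_le
  -- the invariant after `j` rounds
  let inv : ℕ → ℕ × ℕ × ℕ → Regs (BC ⊕ BV) → Prop := fun j s T =>
    s.1 = j ∧ s.2.1 < p ∧ s.2.2 < 2 ^ j ∧ T = encSt (mkC Q p g y)
      { v with r := r₀.drop (B + j * bmM Q p * (bmK Q p + 1)), e := s.2.1, acc := s.2.2, tp := 2 ^ j }
  have hC : ∀ j s T, inv j s T → T (Sum.inr .CT) = [] := fun j s T h => by rw [h.2.2.2]; simp [hct]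
  have hbody : ∀ j (s : ℕ × ℕ × ℕ) (σ : List Bool × List Bool) (T : Regs (BC ⊕ BV)) (w : List Bool),
      j < p.size → σ.2.length ≤ N → inv j s T →
      Impl roundProg (bmDescentStepC p g p.size (bmM Q p) (bmK Q p) ω s) σ (Function.update T (Sum.inr .CT) w)
        (fun s' T' => T' (Sum.inr .CT) = w ∧ inv (j + 1) s' (Function.update T' (Sum.inr .CT) []))
        (23100 * (N + 1) ^ 4) := by
    rintro j ⟨t, e, acc⟩ σ T w hj hσ ⟨ht, hep, haccj, hT⟩
    simp only at ht hep haccj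
    subst ht hT
    have h2j : 2 ^ t ≤ 2 * p := (Nat.pow_le_pow_right two_pos hj.le).trans h2l
    rw [bmDescentStepC_eq, update_encSt_CT]
    simp only
    rw [show bmBlk p.size (bmM Q p) (bmK Q p) ω t = ω ⟨t, hj⟩ by simp [bmBlk, hj]]
    have hround := (impl_round hB hσ
      { v with r := r₀.drop (B + t * bmM Q p * (bmK Q p + 1)), e := e, acc := acc, tp := 2 ^ t, ct := w }
      r₀ (B + t * bmM Q p * (bmK Q p + 1)) (ω ⟨t, hj⟩)
      (fun jj => by rw [hω]; congr 1; ring) rfl hep hx hcnt hcj hee hd hp2i hpw hf1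
      (by simp; omega) (by simpa using h2j)).strengthen (fun be => be.2 < p)
      (fun be σ' h => feedRaw_bmRoundC_snd_lt hp1 _ _ _ _ _ _ h)
    refine (impl_bind_pure hround fun be T' hT' => ?_)
    obtain ⟨hbe, hT'⟩ := hT'
    subst hT'
    refine ⟨by simp, rfl, hbe, ?_, ?_⟩
    · dsimp only
      split <;> (rw [pow_succ]; omega)
    · simp only [update_encSt_CT, hct]
      congr 2
      · ring
      · rw [pow_succ]; ring
  have h := impl_iterM (Sum.inr .CT) roundProg (bmDescentStepC p g p.size (bmM Q p) (bmK Q p) ω) inv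
    (23100 * (N + 1) ^ 4) p.size N hC hbody (List.replicate p.size true) 0 (0, v.e, 0) σ (encSt (mkC Q p g y) v)
    (by simp) hσ ⟨rfl, he, by simp, by congr 1; cases v; simp_all⟩
  simp only [List.length_replicate, Nat.zero_add, update_encSt_CT] at h
  refine (h.weaken fun s T' hT' => ⟨hT'.2.1, hT'.2.2.1, by rw [hT'.2.2.2]⟩).mono ?_
  have hl := hB.l_le
  have hWN : N + 1 ≤ (N + 1) ^ 4 := by
    calc N + 1 = (N + 1) ^ 1 := (pow_one _).symm
      _ ≤ (N + 1) ^ 4 := Nat.pow_le_pow_right (Nat.succ_pos N) (by norm_num)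
  rw [show (N + 1) ^ 5 = (N + 1) ^ 4 * (N + 1) from pow_succ _ _]
  generalize (N + 1) ^ 4 = W at hWN ⊢
  calc p.size * (23100 * W + 2) + 1 ≤ N * (23100 * W + 2) + 1 := by
        have := Nat.mul_le_mul_right (23100 * W + 2) hl; omega
    _ ≤ 23103 * (W * (N + 1)) := by nlinarith

end Descent

end BMMachine
end Literature.Computability.Cryptography
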